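import Mathlib.NumberTheory.AbelSummation
import Literature.NumberTheory.Sieve.AsymptoticSieveForPrimesTyz
import HarnessLib

/-!
# Asymptotic sieve for primes: the evaluation (4.5) of `T(x; Y)` (proof)

Trunk T-SIEVE. Source: J. Friedlander, H. Iwaniec, *Asymptotic sieve for primes*, Ann. of Math. 148
(1998) 1041–1065 [FriedlanderIwaniecASP1998] (= arXiv:math/9811186), §4 "Evaluation of
`T(x; Y)`", pp. 1052–1054, displays (4.1)–(4.5).

This file DISCHARGES the named fact `Literature.NumberTheory.Sieve.fi_asp_T_estimate` (FI (4.5),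
`Literature.NumberTheory.Sieve.AsymptoticSieveForPrimesDecomposition`) MODULO the two named facts
`Literature.NumberTheory.Sieve.fi_moebius_density_cancellation` (FI (2.4)) and `Literature.NumberTheory.Sieve.fi_moebius_density_log_sum`
(FI (1.13)–(1.14)) of `…Inputs`, using the proved reduction `Literature.NumberTheory.Sieve.fi_reduced_remainder_bound_holds`
(FI (R′), `…Reduction`) and the machinery of `…Tyz` (FI (4.3), the `gcd`-twisted (2.4), the
`ν`-sum `∑ g(ν)τ(ν)σ_ν ≪ (log x)²`):
`fi_asp_T_estimate_of_cancellation :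
  fi_moebius_density_cancellation → fi_moebius_density_log_sum → fi_asp_T_estimate`.

## The printed proof (FI §4) and its formalisation

"We are able to treat the sum `T(x; y)` for individual `x, y`. We split this by means of
`log n/b = log n - log b`, getting `T(x; y) = T₁(x; y) + T₂(x; y)`. We have (4.1)
`T₁(x; y) = ∑_{n ≤ x} a_n ρ_n log n ∑_{b ∣ n, b ≤ y} μ(b) = ∑_{b ≤ y} μ(b) ∑_{n ≤ x, n ≡ 0 (b)} a_n ρ_n log n`.
Here the inner sum is, by partial summation, (4.2) `V_b(x) log x - ∫_1^x V_b(t) dt/t` where (4.3)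
`V_b(x) = ∑_{n ≤ x, b ∣ n} a_n ∑_{ν ∣ n} λ_ν = ∑_ν λ_ν A_{[ν,b]}(x) = ∑_ν λ_ν (g([ν,b])A(x) + r_{[ν,b]}(x))`.
We have `g([ν,b]) = g(ν) g(b/(ν,b))` and `∑_{b ≤ y} μ(b) g(b/(ν,b)) = ∑_{d ∣ ν} μ(d) ∑_{b ≤ y/d,
(b,ν)=1} μ(b) g(b)`. This last inner sum is, by (2.4), bounded by `O(σ_ν (log x)^{-6})`. By this and
(4.2) we deduce that the contribution to (4.1) coming from the main term in (4.3) is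
`≪ A(x)(log x)^{-5} ∑_ν |λ_ν| g(ν) τ(ν) σ_ν ≪ A(x)(log x)^{-3}`. The remainder terms in (4.3) make
a contribution to (4.1) which is `≪ (log x) ∑_ν ∑_b |λ_ν μ(b) r_{[ν,b]}(x)| ≪ (log x) ∑^♭_{d < Δy}
τ₃(d)|r_d(x)| ≪ A(x)(log x)^{-2}` by (R′) since `Δy < D`. Thus `T₁(x; y) ≪ A(x)(log x)^{-2}`.
We now consider `T₂(x; y) = -∑_{b ≤ y} μ(b) log b ∑_ν λ_ν A_{[ν,b]}(x)`. We insert (1.7) … The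
remainder terms give … the same bound `≪ A(x)(log x)^{-2}`. Here, however, the main term provides
also the main term for the total sum `S(x)`. This is (4.4) `-A(x) ∑_ν λ_ν g(ν) ∑_{b ≤ y} μ(b)
g(b/(ν,b)) log b`. We extend the summation to all `b` making an error `≪ A(x)(log x)^{-3}`, by
(2.4). Then, we evaluate the complete inner sum as `∑_{η ∣ ν} μ(η) ∑_{(b,ν)=1} μ(b)g(b) log ηb
= ∑_{η ∣ ν} μ(η) ∑_{(b,ν)=1} μ(b) g(b) log b` and this is equal to `-H` if `ν = 1` and equal to
zero otherwise. Thus the sum (4.4), and also `T₂(x, y)` are given by `HA(x) + O(A(x)(log x)^{-2})`.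
Combining this with the bound for `T₁(x, y)` we obtain (4.5) `T(x, y) = HA(x) + O(A(x)(log x)^{-2})`."

* `SieveSequence.fiT_eq_T1_sub_T2`: `T = T₁ - T₂'` from the Leibniz rule
  `ArithmeticFunction.mul_log_add_pmul_log_mul_zeta` (`f * log + (f·log) * 1 = (f * 1)·log`);
  `T₂' = ∑_{b ≤ y} μ(b) log b V_b(x)` (`SieveSequence.rhoSum_truncLE_mul_zeta`), `T₂ = -T₂'`.
* (4.2) is used in DISCRETE form, `abs_sum_Icc_mul_log_le`: if `|∑_{n ≤ N} w_n| ≤ B` for all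
  `N ≤ X` then `|∑_{n ≤ X} w_n log n| ≤ 2B log X` (`log n = ∑_{i<n} log((i+1)/i)`); the partial sums
  `W(N) = ∑_{n ≤ N} a_n ρ_n M_y(n) = ∑_{b ≤ y} μ(b) V_b(N)` are unfolded by (4.3)
  (`IsUpperSieveWeights.sum_filter_dvd_a_mul_sieveRho_eq`, valid at every `t`) and (1.7)
  (`FIAsymptoticSieveHypotheses.sum_phi_V_eq_main_add_rem`), and bounded by (2.4)
  (`abs_fi_T1_mainTerms_le`, `≪ (log x)^{-4}`) and (R′) at `t = N ≤ x`
  (`SieveSequence.abs_pairRemTerms_le`, fiber count `τ(d)² ≤ τ₅(d)`).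
* (4.4): `abs_sum_moebius_density_div_gcd_log_sub_le` — after `b = ηb'`
  (`sum_moebius_density_div_gcd_eq`), `log ηb' = log η + log b'`; the `log η` part is `≪ τ(ν) log ν
  σ_ν (log(y/ν))^{-6}` by (2.4); in the `log b'` part the finite sums `Q_ν(y/η)` are compared with
  `Q_ν(y)` by the tail bound `abs_sum_coprime_moebius_density_log_tail_le` (`3|K|σ_ν (log u)^{-5}`,
  partial summation `abs_sum_Ioc_log_mul_le` from (2.4)), and `∑_{η ∣ ν} μ(η) Q_ν(y) = [ν = 1] Q₁(y)`;
  finally `|Q₁(y) + H| ≤ 3|K| (log y)^{-5}` (`abs_sum_moebius_density_log_add_le`) from the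
  convergence `∑_{b ≤ N} μ(b)g(b) log b → -H` (`fi_moebius_density_log_sum`) by passing to the limit
  in the tail bound. Summed against `λ_ν g(ν)`: `abs_fi_T2_mainTerms_sub_le`.
* `fi_asp_T_estimate_of_cancellation`: in the regime `FIRegime` (`Δ = x^{θ/2}`, `y ∈ [Y, eY]`,
  `Y = Δ⁻¹√D`, `0 < θ < 1/3`): `⌊y⌋⌊Δ⌋ ≤ e√D ≤ D`, `y/Δ ≥ x^{1/3-θ} ≥ e`, and the four bounds give
  `|T(x; y) - HA(x)| ≤ K A(x)(log x)^{-2}` with an explicit (immaterial) `K`.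

## Mathlib search

Mathlib: `sum_mul_eq_sub_sub_integral_mul` (Abel summation, `Mathlib.NumberTheory.AbelSummation`),
`Finset.sum_range_sub` (telescoping), `Finset.sum_Ioc_consecutive`, `Nat.sum_divisorsAntidiagonal`,
`ArithmeticFunction.coe_moebius_mul_coe_zeta` (`∑_{d∣m} μ(d) = [m=1]`), `le_of_tendsto`; the tree:
`…Tyz` (`rhoSum_mul_mul_zeta`, `sum_a_mul_sieveRho_eq_sum_congrSum`,
`abs_sum_moebius_density_div_gcd_le`, `sum_squarefree_density_card_sigmaHalf_le`,
`card_divisors_sq_le_divisorCountK_five`, `fiY_pos_and_ge`). Nothing on `T(x; y)` itself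
(`lean search 'fiT\b'`: only the Decomposition/Assembly files of this series).
-/

noncomputable section

open Filter Finset
open scoped ArithmeticFunction.Moebius ArithmeticFunction.vonMangoldt ArithmeticFunction.zeta
  ArithmeticFunction.omega ArithmeticFunction.sigma

namespace Literature.NumberTheory.Sieve

open MeasureTheory
open scoped Topology

/-! ### Partial summation for log-weighted tails -/

/-- `d/dt (-(1/5) (log t)⁻⁵) = t⁻¹ (log t)⁻⁶` for `t > 1`. [folklore] -/
theorem hasDerivAt_neg_inv_log_pow_five {t : ℝ} (ht : 1 < t) :
    HasDerivAt (fun s : ℝ => -(1 / 5) * (Real.log s ^ 5)⁻¹) (t⁻¹ * (Real.log t ^ 6)⁻¹) t := by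
  have ht0 : t ≠ 0 := by positivity
  have hlog : Real.log t ≠ 0 := (Real.log_pos ht).ne'
  have h1 : HasDerivAt (fun s : ℝ => Real.log s ^ 5) ((5 : ℕ) * Real.log t ^ (5 - 1) * t⁻¹) t :=
    (Real.hasDerivAt_log ht0).pow 5
  have h2 := (h1.inv (pow_ne_zero 5 hlog)).const_mul (-(1 / 5) : ℝ)
  refine h2.congr_deriv ?_
  simp only [Nat.cast_ofNat, show (5 : ℕ) - 1 = 4 from rfl]
  field_simp

/-- The integrand `t⁻¹ (log t)⁻⁶` is continuous on `[u, v]` for `u > 1`. [folklore] -/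
theorem continuousOn_inv_mul_inv_log_pow_six {u v : ℝ} (hu : 1 < u) :
    ContinuousOn (fun t : ℝ => t⁻¹ * (Real.log t ^ 6)⁻¹) (Set.Icc u v) := by
  have hsub : Set.Icc u v ⊆ ({0}ᶜ : Set ℝ) := fun t ht h0 => by
    simp only [Set.mem_singleton_iff] at h0
    linarith [ht.1]
  refine ContinuousOn.mul (continuousOn_inv₀.mono hsub) ?_
  refine ContinuousOn.inv₀ ((Real.continuousOn_log.mono hsub).pow 6) fun t ht => ?_
  exact pow_ne_zero 6 (Real.log_pos (lt_of_lt_of_le hu ht.1)).ne'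

/-- `∫_u^v dt/(t (log t)⁶) ≤ 1/(5 (log u)⁵)` for `1 < u ≤ v`. [folklore] -/
theorem integral_inv_mul_inv_log_pow_six_le {u v : ℝ} (hu : 1 < u) (huv : u ≤ v) :
    ∫ t in u..v, t⁻¹ * (Real.log t ^ 6)⁻¹ ≤ 1 / (5 * Real.log u ^ 5) := by
  have hderiv : ∀ t ∈ Set.uIcc u v, HasDerivAt (fun s : ℝ => -(1 / 5) * (Real.log s ^ 5)⁻¹)
      (t⁻¹ * (Real.log t ^ 6)⁻¹) t := by
    intro t ht
    rw [Set.uIcc_of_le huv] at ht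
    exact hasDerivAt_neg_inv_log_pow_five (lt_of_lt_of_le hu ht.1)
  have hint : IntervalIntegrable (fun t : ℝ => t⁻¹ * (Real.log t ^ 6)⁻¹) volume u v := by
    refine ContinuousOn.intervalIntegrable ?_
    rw [Set.uIcc_of_le huv]
    exact continuousOn_inv_mul_inv_log_pow_six hu
  rw [intervalIntegral.integral_eq_sub_of_hasDerivAt hderiv hint]
  have hlu : 0 < Real.log u := Real.log_pos hu
  have hlv : 0 < Real.log v := Real.log_pos (lt_of_lt_of_le hu huv)
  have h0 : 0 ≤ (1 / 5 : ℝ) * (Real.log v ^ 5)⁻¹ := by positivity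
  calc -(1 / 5) * (Real.log v ^ 5)⁻¹ - -(1 / 5) * (Real.log u ^ 5)⁻¹
      ≤ (1 / 5) * (Real.log u ^ 5)⁻¹ := by linarith
    _ = 1 / (5 * Real.log u ^ 5) := by ring

/-- `|a - b - c| ≤ |a| + |b| + |c|`. [folklore] -/
theorem abs_sub_sub_le (a b c : ℝ) : |a - b - c| ≤ |a| + |b| + |c| := by
  have h1 := abs_add_le (a - b) (-c)
  have h2 := abs_add_le a (-b)
  simp only [abs_neg, ← sub_eq_add_neg] at h1 h2
  linarith

/-- **Partial summation for log-weighted tails** (the step "We extend the summation to all `b`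
making an error `≪ A(x)(log x)^{-3}`, by (2.4)" of FI §4, display (4.4), made quantitative; Abel
summation is Mathlib's `sum_mul_eq_sub_sub_integral_mul`). If `|∑_{k ≤ t} c_k| ≤ B (log t)^{-6}`
for all `t ≥ u`, where `u ≥ e`, then `|∑_{u < k ≤ v} c_k log k| ≤ 3B (log u)^{-5}` for all `v ≥ u`
(`= M(v) log v - M(u) log u - ∫_u^v M(t) dt/t` with `∫_u^∞ dt/(t (log t)^6) = (5 (log u)^5)⁻¹`).
[cite: FriedlanderIwaniecASP1998, §4 (4.4)] -/
theorem abs_sum_Ioc_log_mul_le {c : ℕ → ℝ} {B u : ℝ} (hu : Real.exp 1 ≤ u)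
    (hM : ∀ t : ℝ, u ≤ t → |∑ k ∈ Icc 0 ⌊t⌋₊, c k| ≤ B / Real.log t ^ 6) {v : ℝ} (huv : u ≤ v) :
    |∑ k ∈ Ioc ⌊u⌋₊ ⌊v⌋₊, Real.log k * c k| ≤ 3 * B / Real.log u ^ 5 := by
  have he : (2 : ℝ) ≤ Real.exp 1 := by linarith [Real.add_one_le_exp (1 : ℝ)]
  have hu1 : 1 < u := by linarith
  have hu0 : 0 ≤ u := by linarith
  have hlogu : 1 ≤ Real.log u := by rwa [Real.le_log_iff_exp_le (by linarith)]
  have hlogu0 : 0 < Real.log u := by linarith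
  have hB : 0 ≤ B := by
    by_contra hB
    push Not at hB
    have h := (abs_nonneg _).trans (hM u le_rfl)
    have : B / Real.log u ^ 6 < 0 := div_neg_of_neg_of_pos hB (by positivity)
    linarith
  -- Abel summation
  have hdiff : ∀ t ∈ Set.Icc u v, DifferentiableAt ℝ Real.log t := fun t ht =>
    Real.differentiableAt_log (by linarith [ht.1])
  have hint : IntegrableOn (deriv Real.log) (Set.Icc u v) := by
    rw [Real.deriv_log']
    refine ContinuousOn.integrableOn_Icc (continuousOn_inv₀.mono fun t ht h0 => ?_)
    simp only [Set.mem_singleton_iff] at h0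
    linarith [ht.1]
  rw [sum_mul_eq_sub_sub_integral_mul c hu0 huv hdiff hint, Real.deriv_log']
  -- the three terms
  have hlogv : Real.log u ≤ Real.log v := Real.log_le_log (by linarith) huv
  have hlogv0 : 0 < Real.log v := by linarith
  have hlv : Real.log v ≠ 0 := hlogv0.ne'
  have hlu : Real.log u ≠ 0 := hlogu0.ne'
  have h1 : |Real.log v * ∑ k ∈ Icc 0 ⌊v⌋₊, c k| ≤ B / Real.log u ^ 5 := by
    rw [abs_mul, abs_of_pos hlogv0]
    calc Real.log v * |∑ k ∈ Icc 0 ⌊v⌋₊, c k| ≤ Real.log v * (B / Real.log v ^ 6) :=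
          mul_le_mul_of_nonneg_left (hM v huv) hlogv0.le
      _ = B / Real.log v ^ 5 := by field_simp
      _ ≤ B / Real.log u ^ 5 := div_le_div_of_nonneg_left hB (by positivity) (by gcongr)
  have h2 : |Real.log u * ∑ k ∈ Icc 0 ⌊u⌋₊, c k| ≤ B / Real.log u ^ 5 := by
    rw [abs_mul, abs_of_pos hlogu0]
    calc Real.log u * |∑ k ∈ Icc 0 ⌊u⌋₊, c k| ≤ Real.log u * (B / Real.log u ^ 6) :=
          mul_le_mul_of_nonneg_left (hM u le_rfl) hlogu0.le
      _ = B / Real.log u ^ 5 := by field_simp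
  have h3 : |∫ t in Set.Ioc u v, t⁻¹ * ∑ k ∈ Icc 0 ⌊t⌋₊, c k| ≤ B / (5 * Real.log u ^ 5) := by
    rw [← intervalIntegral.integral_of_le huv, ← Real.norm_eq_abs]
    have hbound : ∀ᵐ t : ℝ, t ∈ Set.Ioc u v →
        ‖t⁻¹ * ∑ k ∈ Icc 0 ⌊t⌋₊, c k‖ ≤ B * (t⁻¹ * (Real.log t ^ 6)⁻¹) := by
      refine Filter.Eventually.of_forall fun t ht => ?_
      have ht0 : 0 < t := by linarith [ht.1]
      rw [Real.norm_eq_abs, abs_mul, abs_of_pos (inv_pos.mpr ht0)]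
      calc t⁻¹ * |∑ k ∈ Icc 0 ⌊t⌋₊, c k| ≤ t⁻¹ * (B / Real.log t ^ 6) :=
            mul_le_mul_of_nonneg_left (hM t ht.1.le) (inv_pos.mpr ht0).le
        _ = B * (t⁻¹ * (Real.log t ^ 6)⁻¹) := by rw [div_eq_mul_inv]; ring
    have hcont : IntervalIntegrable (fun t : ℝ => B * (t⁻¹ * (Real.log t ^ 6)⁻¹)) volume u v := by
      refine ContinuousOn.intervalIntegrable ?_
      rw [Set.uIcc_of_le huv]
      exact (continuousOn_inv_mul_inv_log_pow_six hu1).const_smul B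
    refine (intervalIntegral.norm_integral_le_of_norm_le huv hbound hcont).trans ?_
    rw [intervalIntegral.integral_const_mul]
    calc B * ∫ t in u..v, t⁻¹ * (Real.log t ^ 6)⁻¹ ≤ B * (1 / (5 * Real.log u ^ 5)) :=
          mul_le_mul_of_nonneg_left (integral_inv_mul_inv_log_pow_six_le hu1 huv) hB
      _ = B / (5 * Real.log u ^ 5) := by rw [mul_one_div]
  refine (abs_sub_sub_le _ _ _).trans ?_
  have h15 : B / (5 * Real.log u ^ 5) ≤ B / Real.log u ^ 5 :=
    div_le_div_of_nonneg_left hB (by positivity) (by nlinarith [pow_pos hlogu0 5])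
  have : B / Real.log u ^ 5 + B / Real.log u ^ 5 + B / (5 * Real.log u ^ 5) ≤ 3 * B / Real.log u ^ 5 := by
    rw [show 3 * B / Real.log u ^ 5 = B / Real.log u ^ 5 + B / Real.log u ^ 5 + B / Real.log u ^ 5 by ring]
    linarith
  linarith

/-! ### The substitution `b = η b'`, `η = (b, ν)` -/

/-- **`b = η b'` with `η = (b, ν)`** (FI §4 p. 1053: "`∑_{b ≤ y} μ(b) g(b/(ν, b)) = ∑_{d ∣ ν} μ(d)
∑_{b ≤ y/d, (b, ν) = 1} μ(b) g(b)`"), with an arbitrary weight `φ` and an extra coprimality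
condition `(b, k) = 1`: for squarefree `ν`, `k ≥ 1`, `y ≥ 0`,
`∑_{b ≤ y sqfree, (b,k)=1} μ(b) g(b/(b,ν)) φ(b)
  = ∑_{η ∣ ν, (η,k)=1} μ(η) ∑_{b' ≤ y/η sqfree, (b',νk)=1} μ(b') g(b') φ(ηb')`.
[cite: FriedlanderIwaniecASP1998, §4 p. 1053] -/
theorem sum_moebius_density_div_gcd_eq {g : ArithmeticFunction ℝ} (φ : ℕ → ℝ) {ν : ℕ} (k : ℕ)
    (hν : Squarefree ν) {y : ℝ} (hy : 0 ≤ y) :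
    ∑ b ∈ (Icc 1 ⌊y⌋₊).filter (fun b : ℕ => Squarefree b ∧ b.Coprime k),
        (μ b : ℝ) * g (b / Nat.gcd b ν) * φ b =
      ∑ η ∈ ν.divisors.filter (fun η : ℕ => η.Coprime k), (μ η : ℝ) *
        ∑ b' ∈ (Icc 1 ⌊y / η⌋₊).filter (fun b' : ℕ => Squarefree b' ∧ b'.Coprime (ν * k)),
          (μ b' : ℝ) * g b' * φ (η * b') := by
  classical
  have hν0 : ν ≠ 0 := hν.ne_zero
  set U := (Icc 1 ⌊y⌋₊).filter (fun b : ℕ => Squarefree b ∧ b.Coprime k) with hU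
  set S := ν.divisors.filter (fun η : ℕ => η.Coprime k) with hS
  set t : ℕ → Finset ℕ := fun η =>
    (Icc 1 ⌊y / η⌋₊).filter (fun b' : ℕ => Squarefree b' ∧ b'.Coprime (ν * k)) with ht
  have hbij : ∑ b ∈ U, (μ b : ℝ) * g (b / Nat.gcd b ν) * φ b =
      ∑ p ∈ S.sigma t, (μ p.1 : ℝ) * ((μ p.2 : ℝ) * g p.2 * φ (p.1 * p.2)) := by
    refine Finset.sum_nbij' (fun b => (⟨Nat.gcd b ν, b / Nat.gcd b ν⟩ : Σ _ : ℕ, ℕ))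
      (fun p => p.1 * p.2) ?_ ?_ ?_ ?_ ?_
    · intro b hb
      obtain ⟨hb1, hbsq, hbk⟩ := Finset.mem_filter.mp hb
      obtain ⟨hb1', hby⟩ := Finset.mem_Icc.mp hb1
      have hη : Nat.gcd b ν ∣ ν := Nat.gcd_dvd_right b ν
      have hηb : Nat.gcd b ν ∣ b := Nat.gcd_dvd_left b ν
      have hη0 : 0 < Nat.gcd b ν := Nat.gcd_pos_of_pos_left ν hb1'
      refine Finset.mem_sigma.mpr ⟨Finset.mem_filter.mpr ⟨Nat.mem_divisors.mpr ⟨hη, hν0⟩,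
        Nat.Coprime.coprime_dvd_left hηb hbk⟩, Finset.mem_filter.mpr ⟨?_, ?_, ?_⟩⟩
      · refine Finset.mem_Icc.mpr ⟨Nat.div_pos (Nat.le_of_dvd hb1' hηb) hη0, Nat.le_floor ?_⟩
        rw [Nat.cast_div hηb (by exact_mod_cast hη0.ne'),
          div_le_div_iff_of_pos_right (by exact_mod_cast hη0)]
        exact (Nat.cast_le.mpr hby).trans (Nat.floor_le hy)
      · exact hbsq.squarefree_of_dvd (Nat.div_dvd_of_dvd hηb)
      · exact Nat.Coprime.mul_right (Nat.coprime_div_gcd_of_squarefree hbsq hν0)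
          (Nat.Coprime.coprime_dvd_left (Nat.div_dvd_of_dvd hηb) hbk)
    · rintro ⟨η, b'⟩ hp
      obtain ⟨hη, hb'⟩ := Finset.mem_sigma.mp hp
      obtain ⟨hη1, hηk⟩ := Finset.mem_filter.mp hη
      obtain ⟨hη2, -⟩ := Nat.mem_divisors.mp hη1
      obtain ⟨hb'1, hb'sq, hb'k⟩ := Finset.mem_filter.mp hb'
      obtain ⟨hb'1', hb'y⟩ := Finset.mem_Icc.mp hb'1
      have hη0 : 0 < η := Nat.pos_of_dvd_of_pos hη2 (Nat.pos_of_ne_zero hν0)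
      have hcop : η.Coprime b' :=
        (Nat.Coprime.coprime_dvd_right hη2 (Nat.Coprime.coprime_mul_right_right hb'k)).symm
      refine Finset.mem_filter.mpr ⟨Finset.mem_Icc.mpr ⟨Nat.mul_pos hη0 hb'1', ?_⟩, ?_, ?_⟩
      · refine Nat.le_floor ?_
        have : (b' : ℝ) ≤ y / η := (Nat.cast_le.mpr hb'y).trans (Nat.floor_le (by positivity))
        rw [le_div_iff₀ (by exact_mod_cast hη0)] at this
        push_cast
        linarith
      · exact Nat.squarefree_mul_iff.mpr ⟨hcop, hν.squarefree_of_dvd hη2, hb'sq⟩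
      · exact Nat.Coprime.mul_left hηk (Nat.Coprime.coprime_mul_left_right hb'k)
    · intro b _
      exact Nat.mul_div_cancel' (Nat.gcd_dvd_left b ν)
    · rintro ⟨η, b'⟩ hp
      dsimp only at hp ⊢
      obtain ⟨hη, hb'⟩ := Finset.mem_sigma.mp hp
      obtain ⟨hη1, -⟩ := Finset.mem_filter.mp hη
      obtain ⟨hη2, -⟩ := Nat.mem_divisors.mp hη1
      obtain ⟨-, -, hb'k⟩ := Finset.mem_filter.mp hb'
      have hη0 : 0 < η := Nat.pos_of_dvd_of_pos hη2 (Nat.pos_of_ne_zero hν0)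
      have hgcd : Nat.gcd (η * b') ν = η := by
        obtain ⟨q, hq⟩ := hη2
        have hb'q : b'.Coprime q :=
          Nat.Coprime.coprime_dvd_right ⟨η, by rw [hq, mul_comm]⟩
            (Nat.Coprime.coprime_mul_right_right hb'k)
        conv_lhs => rw [hq]
        rw [Nat.gcd_mul_left, hb'q.gcd_eq_one, mul_one]
      simp only [hgcd, Nat.mul_div_cancel_left b' hη0]
    · intro b hb
      obtain ⟨-, hbsq, -⟩ := Finset.mem_filter.mp hb
      have hηb : Nat.gcd b ν ∣ b := Nat.gcd_dvd_left b ν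
      have hsplit : b = Nat.gcd b ν * (b / Nat.gcd b ν) := (Nat.mul_div_cancel' hηb).symm
      have hcop : (Nat.gcd b ν).Coprime (b / Nat.gcd b ν) := by
        refine Nat.coprime_of_squarefree_mul ?_
        rwa [← hsplit]
      have hμ : (μ b : ℝ) = (μ (Nat.gcd b ν) : ℝ) * (μ (b / Nat.gcd b ν) : ℝ) := by
        conv_lhs => rw [hsplit]
        rw [ArithmeticFunction.isMultiplicative_moebius.map_mul_of_coprime hcop, Int.cast_mul]
      simp only
      rw [hμ, ← hsplit]
      ring
  rw [hbij, Finset.sum_sigma]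
  exact Finset.sum_congr rfl fun η _ => by rw [Finset.mul_sum]


/-! ### Discrete partial summation against `log` -/

/-- **Discrete partial summation against `log`** (the step (4.2) of FI §4, "the inner sum is, by
partial summation, `V_b(x) log x - ∫_1^x V_b(t) dt/t`", in the discrete form
`log n = ∑_{i < n} (log(i+1) - log i)`): if all partial sums `W(N) = ∑_{n ≤ N} w_n`, `N ≤ X`,
satisfy `|W(N)| ≤ B`, then `|∑_{n ≤ X} w_n log n| ≤ 2B log X`.
[cite: FriedlanderIwaniecASP1998, §4 (4.2)] -/
theorem abs_sum_Icc_mul_log_le {w : ℕ → ℝ} {B : ℝ} {X : ℕ}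
    (hB : ∀ N : ℕ, N ≤ X → |∑ n ∈ Icc 1 N, w n| ≤ B) :
    |∑ n ∈ Icc 1 X, w n * Real.log n| ≤ 2 * B * Real.log X := by
  have hB0 : 0 ≤ B := (abs_nonneg _).trans (hB 0 (Nat.zero_le X))
  set ℓ : ℕ → ℝ := fun i => Real.log ((i + 1 : ℕ) : ℝ) - Real.log (i : ℝ) with hℓ
  have hℓ0 : ∀ i, 0 ≤ ℓ i := by
    intro i
    simp only [hℓ, sub_nonneg]
    rcases Nat.eq_zero_or_pos i with rfl | hi
    · simp
    · exact Real.log_le_log (by exact_mod_cast hi) (by exact_mod_cast (Nat.le_succ i))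
  -- telescoping
  have htel : ∀ n : ℕ, ∑ i ∈ range n, ℓ i = Real.log n := by
    intro n
    have := Finset.sum_range_sub (fun i : ℕ => Real.log (i : ℝ)) n
    simp only [Nat.cast_zero, Real.log_zero, sub_zero] at this
    simpa [hℓ] using this
  -- the partial sums over `Icc (i+1) X`
  have hIcc : ∀ n : ℕ, Icc 1 n = Ioc 0 n := by
    intro n; ext k; simp only [Finset.mem_Icc, Finset.mem_Ioc]; omega
  have htail : ∀ i : ℕ, i ≤ X → ∑ n ∈ Ioc i X, w n = ∑ n ∈ Icc 1 X, w n - ∑ n ∈ Icc 1 i, w n := by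
    intro i hi
    rw [hIcc, hIcc, ← Finset.sum_Ioc_consecutive w (Nat.zero_le i) hi]
    ring
  have htail_abs : ∀ i : ℕ, i ≤ X → |∑ n ∈ Ioc i X, w n| ≤ 2 * B := by
    intro i hi
    rw [htail i hi]
    have h1 := hB X le_rfl
    have h2 := hB i hi
    calc |∑ n ∈ Icc 1 X, w n - ∑ n ∈ Icc 1 i, w n|
        ≤ |∑ n ∈ Icc 1 X, w n| + |∑ n ∈ Icc 1 i, w n| := abs_sub _ _
      _ ≤ B + B := add_le_add h1 h2
      _ = 2 * B := by ring
  -- swap the sums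
  have hswap : ∑ n ∈ Icc 1 X, w n * Real.log n = ∑ i ∈ range X, ℓ i * ∑ n ∈ Ioc i X, w n := by
    calc ∑ n ∈ Icc 1 X, w n * Real.log n = ∑ n ∈ Icc 1 X, ∑ i ∈ range n, w n * ℓ i := by
          refine Finset.sum_congr rfl fun n _ => ?_
          rw [← htel n, Finset.mul_sum]
      _ = ∑ i ∈ range X, ∑ n ∈ Ioc i X, w n * ℓ i := by
          refine Finset.sum_comm' fun n i => ?_
          simp only [Finset.mem_Icc, Finset.mem_range, Finset.mem_Ioc]
          omega
      _ = ∑ i ∈ range X, ℓ i * ∑ n ∈ Ioc i X, w n := by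
          refine Finset.sum_congr rfl fun i _ => ?_
          rw [Finset.mul_sum]
          exact Finset.sum_congr rfl fun n _ => mul_comm _ _
  rw [hswap]
  calc |∑ i ∈ range X, ℓ i * ∑ n ∈ Ioc i X, w n|
      ≤ ∑ i ∈ range X, |ℓ i * ∑ n ∈ Ioc i X, w n| := Finset.abs_sum_le_sum_abs _ _
    _ ≤ ∑ i ∈ range X, ℓ i * (2 * B) := by
        refine Finset.sum_le_sum fun i hi => ?_
        rw [abs_mul, abs_of_nonneg (hℓ0 i)]
        exact mul_le_mul_of_nonneg_left (htail_abs i (Finset.mem_range.mp hi).le) (hℓ0 i)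
    _ = 2 * B * Real.log X := by rw [← Finset.sum_mul, htel X]; ring

/-- Passing to the limit in a tail bound: if `|Q(N) - q| ≤ ε` for all `N ≥ N₀` and `Q(N) → S`,
then `|S - q| ≤ ε`. [folklore] -/
theorem abs_lim_sub_le_of_tail {Q : ℕ → ℝ} {S q ε : ℝ} {N₀ : ℕ}
    (h : ∀ N : ℕ, N₀ ≤ N → |Q N - q| ≤ ε) (hlim : Tendsto Q atTop (𝓝 S)) : |S - q| ≤ ε :=
  le_of_tendsto ((hlim.sub_const q).abs) (Filter.eventually_atTop.2 ⟨N₀, h⟩)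

/-- `∑_{d ∣ m} μ(d) = [m = 1]` in `ℝ` (Mathlib's `μ * ζ = 1`). [folklore] -/
theorem sum_divisors_moebius_eq_ite (m : ℕ) :
    ∑ d ∈ m.divisors, (μ d : ℝ) = if m = 1 then 1 else 0 := by
  have h := congrArg (fun f : ArithmeticFunction ℝ => f m)
    (ArithmeticFunction.coe_moebius_mul_coe_zeta (R := ℝ))
  simpa only [ArithmeticFunction.coe_mul_zeta_apply, ArithmeticFunction.intCoe_apply,
    ArithmeticFunction.one_apply] using h

/-! ### The tails of the logarithmic Möbius–density sums -/

/-- **Tails of `∑_{(b, ν) = 1} μ(b) g(b) log b`** (FI §4: "We extend the summation to all `b`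
making an error `≪ A(x)(log x)^{-3}`, by (2.4)"): if (2.4) holds with constant `K` then for
`ν ≥ 1` and `e ≤ u ≤ v`,
`|∑_{u < b ≤ v, (b,ν)=1} μ(b) g(b) log b| ≤ 3|K| σ_ν (log u)^{-5}`.
[cite: FriedlanderIwaniecASP1998, §4 (4.4)] -/
theorem abs_sum_coprime_moebius_density_log_tail_le {g : ArithmeticFunction ℝ} {K : ℝ}
    (h24 : ∀ ν : ℕ, 1 ≤ ν → ∀ y : ℝ, 2 ≤ y →
      |∑ d ∈ (Icc 1 ⌊y⌋₊).filter (fun d : ℕ => d.Coprime ν), (μ d : ℝ) * g d| ≤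
        K * sigmaHalf ν / Real.log y ^ 6)
    {ν : ℕ} (hν : 1 ≤ ν) {u v : ℝ} (hu : Real.exp 1 ≤ u) (huv : u ≤ v) :
    |(∑ b ∈ (Icc 1 ⌊v⌋₊).filter (fun b : ℕ => b.Coprime ν), (μ b : ℝ) * g b * Real.log b) -
        ∑ b ∈ (Icc 1 ⌊u⌋₊).filter (fun b : ℕ => b.Coprime ν), (μ b : ℝ) * g b * Real.log b| ≤
      3 * (|K| * sigmaHalf ν) / Real.log u ^ 5 := by
  classical
  have he : (2 : ℝ) ≤ Real.exp 1 := by linarith [Real.add_one_le_exp (1 : ℝ)]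
  have hu0 : 0 ≤ u := by linarith
  set c : ℕ → ℝ := fun k => if k.Coprime ν then (μ k : ℝ) * g k else 0 with hc
  have hc0 : c 0 = 0 := by simp [hc]
  have hIcc0 : ∀ n : ℕ, Icc 0 n = insert 0 (Icc 1 n) := by
    intro n; ext k; simp only [Finset.mem_Icc, Finset.mem_insert]; omega
  -- the hypothesis of the partial-summation lemma
  have hM : ∀ t : ℝ, u ≤ t → |∑ k ∈ Icc 0 ⌊t⌋₊, c k| ≤ |K| * sigmaHalf ν / Real.log t ^ 6 := by
    intro t ht
    have ht2 : 2 ≤ t := by linarith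
    rw [hIcc0, Finset.sum_insert (by simp), hc0, zero_add]
    have : ∑ k ∈ Icc 1 ⌊t⌋₊, c k =
        ∑ d ∈ (Icc 1 ⌊t⌋₊).filter (fun d : ℕ => d.Coprime ν), (μ d : ℝ) * g d := by
      rw [Finset.sum_filter]
    rw [this]
    refine (h24 ν hν t ht2).trans ?_
    have hlog : 0 < Real.log t := Real.log_pos (by linarith)
    have hσ : 0 ≤ sigmaHalf ν := zero_le_one.trans (one_le_sigmaHalf ν)
    exact div_le_div_of_nonneg_right (mul_le_mul_of_nonneg_right (le_abs_self K) hσ)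
      (by positivity)
  have h := abs_sum_Ioc_log_mul_le hu hM huv
  -- identify the `Ioc`-sum with the difference
  have hIcc : ∀ n : ℕ, Icc 1 n = Ioc 0 n := by
    intro n; ext k; simp only [Finset.mem_Icc, Finset.mem_Ioc]; omega
  have hQ : ∀ t : ℝ, ∑ b ∈ (Icc 1 ⌊t⌋₊).filter (fun b : ℕ => b.Coprime ν),
      (μ b : ℝ) * g b * Real.log b = ∑ k ∈ Ioc 0 ⌊t⌋₊, Real.log k * c k := by
    intro t
    rw [Finset.sum_filter, hIcc]
    refine Finset.sum_congr rfl fun k _ => ?_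
    simp only [hc]
    split_ifs <;> ring
  rw [hQ, hQ, ← Finset.sum_Ioc_consecutive _ (Nat.zero_le _) (Nat.floor_le_floor huv),
    add_sub_cancel_left]
  calc |∑ k ∈ Ioc ⌊u⌋₊ ⌊v⌋₊, Real.log k * c k| ≤ 3 * (|K| * sigmaHalf ν) / Real.log u ^ 5 := h

/-- **The complete logarithmic sum** (FI p. 1054: the complete inner sum "is equal to `-H` if
`ν = 1`"; here with the rate supplied by (2.4)): if `∑_{b ≤ N} μ(b) g(b) log b → -H` then for
`y ≥ e`, `|∑_{b ≤ y} μ(b) g(b) log b + H| ≤ 3|K| (log y)^{-5}`.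
[cite: FriedlanderIwaniecASP1998, §4 (4.4)-(4.5)] -/
theorem abs_sum_moebius_density_log_add_le {g : ArithmeticFunction ℝ} {K H : ℝ}
    (h24 : ∀ ν : ℕ, 1 ≤ ν → ∀ y : ℝ, 2 ≤ y →
      |∑ d ∈ (Icc 1 ⌊y⌋₊).filter (fun d : ℕ => d.Coprime ν), (μ d : ℝ) * g d| ≤
        K * sigmaHalf ν / Real.log y ^ 6)
    (h13 : Tendsto (fun N : ℕ => ∑ b ∈ Icc 1 N, (μ b : ℝ) * g b * Real.log b) atTop (𝓝 (-H)))
    {y : ℝ} (hy : Real.exp 1 ≤ y) :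
    |(∑ b ∈ Icc 1 ⌊y⌋₊, (μ b : ℝ) * g b * Real.log b) + H| ≤ 3 * |K| / Real.log y ^ 5 := by
  have hfilt : ∀ n : ℕ, (Icc 1 n).filter (fun b : ℕ => b.Coprime 1) = Icc 1 n := fun n =>
    Finset.filter_true_of_mem fun b _ => Nat.coprime_one_right b
  have htail : ∀ N : ℕ, ⌈y⌉₊ ≤ N →
      |(∑ b ∈ Icc 1 N, (μ b : ℝ) * g b * Real.log b) -
        ∑ b ∈ Icc 1 ⌊y⌋₊, (μ b : ℝ) * g b * Real.log b| ≤ 3 * |K| / Real.log y ^ 5 := by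
    intro N hN
    have hyN : y ≤ N := (Nat.le_ceil y).trans (by exact_mod_cast hN)
    have h := abs_sum_coprime_moebius_density_log_tail_le h24 le_rfl hy hyN
    rw [hfilt, hfilt, Nat.floor_natCast, sigmaHalf_one, mul_one] at h
    exact h
  have h := abs_lim_sub_le_of_tail htail h13
  rwa [abs_sub_comm, sub_neg_eq_add] at h


/-! ### The Möbius–density sums with the `gcd` twist: the case `k = 1` and the `log`-weighted sum -/

/-- The case `k = 1` of `abs_sum_moebius_density_div_gcd_le` (FI §4: "This last inner sum is, by
(2.4), bounded by `O(σ_ν (log x)^{-6})`"): for squarefree `ν` and `y ≥ 2ν`,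
`|∑_{b ≤ y sqfree} μ(b) g(b/(b, ν))| ≤ τ(ν) |K| σ_ν (log(y/ν))^{-6}`.
[cite: FriedlanderIwaniecASP1998, §4 p. 1053] -/
theorem abs_sum_moebius_density_div_gcd_le_one {g : ArithmeticFunction ℝ} {K : ℝ}
    (h24 : ∀ ν : ℕ, 1 ≤ ν → ∀ y : ℝ, 2 ≤ y →
      |∑ d ∈ (Icc 1 ⌊y⌋₊).filter (fun d : ℕ => d.Coprime ν), (μ d : ℝ) * g d| ≤
        K * sigmaHalf ν / Real.log y ^ 6)
    {ν : ℕ} (hν : Squarefree ν) {y : ℝ} (hy : 2 * (ν : ℝ) ≤ y) :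
    |∑ b ∈ (Icc 1 ⌊y⌋₊).filter Squarefree, (μ b : ℝ) * g (b / Nat.gcd b ν)| ≤
      (ν.divisors.card : ℝ) * (|K| * sigmaHalf ν / Real.log (y / ν) ^ 6) := by
  have h := abs_sum_moebius_density_div_gcd_le h24 hν (le_refl 1) hy
  have hf : (Icc 1 ⌊y⌋₊).filter (fun b : ℕ => Squarefree b ∧ b.Coprime 1) =
      (Icc 1 ⌊y⌋₊).filter Squarefree :=
    Finset.filter_congr fun b _ => by simp only [Nat.coprime_one_right_eq_true, and_true]
  rwa [hf, mul_one] at h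

/-- **The inner sum of the main term (4.4)** (FI §4 p. 1053–1054: "We extend the summation to
all `b` making an error `≪ A(x)(log x)^{-3}`, by (2.4). Then, we evaluate the complete inner sum as
`∑_{η ∣ ν} μ(η) ∑_{(b,ν)=1} μ(b) g(b) log ηb = ∑_{η ∣ ν} μ(η) ∑_{(b,ν)=1} μ(b) g(b) log b` and
this is equal to `-H` if `ν = 1` and equal to zero otherwise"; here in finite form, the complete
sum for `ν = 1` being kept as `∑_{b ≤ y} μ(b) g(b) log b`): for squarefree `ν` and `y ≥ eν`,
`|∑_{b ≤ y sqfree} μ(b) g(b/(b,ν)) log b - [ν = 1] ∑_{b ≤ y} μ(b) g(b) log b|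
  ≤ τ(ν) |K| σ_ν (log ν (log(y/ν))^{-6} + 3 (log(y/ν))^{-5})`.
[cite: FriedlanderIwaniecASP1998, §4 (4.4)] -/
theorem abs_sum_moebius_density_div_gcd_log_sub_le {g : ArithmeticFunction ℝ} {K : ℝ}
    (h24 : ∀ ν : ℕ, 1 ≤ ν → ∀ y : ℝ, 2 ≤ y →
      |∑ d ∈ (Icc 1 ⌊y⌋₊).filter (fun d : ℕ => d.Coprime ν), (μ d : ℝ) * g d| ≤
        K * sigmaHalf ν / Real.log y ^ 6)
    {ν : ℕ} (hν : Squarefree ν) {y : ℝ} (hy : Real.exp 1 * ν ≤ y) :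
    |(∑ b ∈ (Icc 1 ⌊y⌋₊).filter Squarefree, (μ b : ℝ) * g (b / Nat.gcd b ν) * Real.log b) -
        (if ν = 1 then ∑ b ∈ Icc 1 ⌊y⌋₊, (μ b : ℝ) * g b * Real.log b else 0)| ≤
      (ν.divisors.card : ℝ) * (|K| * sigmaHalf ν) *
        (Real.log ν / Real.log (y / ν) ^ 6 + 3 / Real.log (y / ν) ^ 5) := by
  classical
  have hν0 : ν ≠ 0 := hν.ne_zero
  have hν1 : 1 ≤ ν := Nat.pos_of_ne_zero hν0
  have hν1r : (1 : ℝ) ≤ ν := by exact_mod_cast hν1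
  have hνpos : (0 : ℝ) < ν := by linarith
  have he : (2 : ℝ) ≤ Real.exp 1 := by linarith [Real.add_one_le_exp (1 : ℝ)]
  have hyν : Real.exp 1 ≤ y / ν := by rw [le_div_iff₀ hνpos]; exact hy
  have hy0 : 0 ≤ y := by
    have : 0 ≤ Real.exp 1 * ν := by positivity
    linarith
  have hyν2 : 2 ≤ y / ν := he.trans hyν
  have hlogyν : 0 < Real.log (y / ν) := Real.log_pos (by linarith)
  have hσ : 0 ≤ sigmaHalf ν := zero_le_one.trans (one_le_sigmaHalf ν)
  -- the (2.4)-sums without and with `log`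
  set P : ℝ → ℝ := fun s =>
    ∑ d ∈ (Icc 1 ⌊s⌋₊).filter (fun d : ℕ => d.Coprime ν), (μ d : ℝ) * g d with hP
  set Q : ℝ → ℝ := fun s =>
    ∑ d ∈ (Icc 1 ⌊s⌋₊).filter (fun d : ℕ => d.Coprime ν), (μ d : ℝ) * g d * Real.log d with hQ
  -- Step 1: the substitution `b = η b'`
  have hsub := sum_moebius_density_div_gcd_eq (g := g) (fun b => Real.log b) 1 hν hy0
  have hf1 : (Icc 1 ⌊y⌋₊).filter (fun b : ℕ => Squarefree b ∧ b.Coprime 1) =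
      (Icc 1 ⌊y⌋₊).filter Squarefree :=
    Finset.filter_congr fun b _ => by simp only [Nat.coprime_one_right_eq_true, and_true]
  have hf2 : ν.divisors.filter (fun η : ℕ => η.Coprime 1) = ν.divisors :=
    Finset.filter_true_of_mem fun η _ => Nat.coprime_one_right η
  rw [hf1, hf2] at hsub
  simp only [mul_one] at hsub
  set t : ℕ → Finset ℕ := fun η =>
    (Icc 1 ⌊y / η⌋₊).filter (fun b' : ℕ => Squarefree b' ∧ b'.Coprime ν) with ht
  -- Step 2: on each `η ∣ ν`, `log(η b') = log η + log b'` and the squarefree condition is dropped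
  have hsplit : ∀ η ∈ ν.divisors, ∑ b' ∈ t η, (μ b' : ℝ) * g b' * Real.log ((η * b' : ℕ) : ℝ) =
      Real.log η * P (y / η) + Q (y / η) := by
    intro η hη
    have hη0 : η ≠ 0 := (Nat.pos_of_mem_divisors hη).ne'
    have h1 : ∑ b' ∈ t η, (μ b' : ℝ) * g b' * Real.log ((η * b' : ℕ) : ℝ) =
        ∑ b' ∈ t η, (Real.log η * ((μ b' : ℝ) * g b') + (μ b' : ℝ) * g b' * Real.log b') := by
      refine Finset.sum_congr rfl fun b' hb' => ?_
      have hb'0 : b' ≠ 0 := by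
        have := (Finset.mem_Icc.mp (Finset.mem_filter.mp hb').1).1; omega
      rw [Nat.cast_mul, Real.log_mul (by exact_mod_cast hη0) (by exact_mod_cast hb'0)]
      ring
    rw [h1, Finset.sum_add_distrib, ← Finset.mul_sum]
    have hset : t η = ((Icc 1 ⌊y / (η : ℝ)⌋₊).filter (fun b' : ℕ => b'.Coprime ν)).filter
        Squarefree := by
      ext b'; simp only [ht, Finset.mem_filter]; tauto
    have hdropP : ∑ b' ∈ t η, (μ b' : ℝ) * g b' = P (y / η) := by
      rw [hset, Finset.sum_filter_of_ne]
      intro b' _ hne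
      by_contra hsq
      exact hne (by rw [ArithmeticFunction.moebius_eq_zero_of_not_squarefree hsq, Int.cast_zero,
        zero_mul])
    have hdropQ : ∑ b' ∈ t η, (μ b' : ℝ) * g b' * Real.log b' = Q (y / η) := by
      rw [hset, Finset.sum_filter_of_ne]
      intro b' _ hne
      by_contra hsq
      exact hne (by rw [ArithmeticFunction.moebius_eq_zero_of_not_squarefree hsq, Int.cast_zero,
        zero_mul, zero_mul])
    rw [hdropP, hdropQ]
  have hmain : ∑ η ∈ ν.divisors, (μ η : ℝ) *
      ∑ b' ∈ t η, (μ b' : ℝ) * g b' * Real.log ((η * b' : ℕ) : ℝ) =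
      (∑ η ∈ ν.divisors, (μ η : ℝ) * Real.log η * P (y / η)) +
        (∑ η ∈ ν.divisors, (μ η : ℝ)) * Q y +
        ∑ η ∈ ν.divisors, (μ η : ℝ) * (Q (y / η) - Q y) := by
    rw [Finset.sum_congr rfl fun η hη => by rw [hsplit η hη], Finset.sum_mul,
      ← Finset.sum_add_distrib, ← Finset.sum_add_distrib]
    exact Finset.sum_congr rfl fun η _ => by ring
  -- the `ν = 1` term
  have hone : (∑ η ∈ ν.divisors, (μ η : ℝ)) * Q y =
      if ν = 1 then ∑ b ∈ Icc 1 ⌊y⌋₊, (μ b : ℝ) * g b * Real.log b else 0 := by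
    rw [sum_divisors_moebius_eq_ite]
    split_ifs with h1
    · subst h1
      rw [one_mul, hQ]
      simp only
      rw [Finset.filter_true_of_mem fun b _ => Nat.coprime_one_right b]
    · rw [zero_mul]
  rw [hsub, hmain, hone]
  have hrw : ∀ a b c : ℝ, a + b + c - b = a + c := fun a b c => by ring
  rw [hrw]
  -- Step 3: the two error terms
  have hτ : ((ν.divisors.filter fun _ => True).card : ℝ) ≤ ν.divisors.card := by
    exact_mod_cast Finset.card_filter_le _ _
  have hE1 : |∑ η ∈ ν.divisors, (μ η : ℝ) * Real.log η * P (y / η)| ≤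
      (ν.divisors.card : ℝ) * (Real.log ν * (|K| * sigmaHalf ν / Real.log (y / ν) ^ 6)) := by
    refine (Finset.abs_sum_le_sum_abs _ _).trans ?_
    have hterm : ∀ η ∈ ν.divisors, |(μ η : ℝ) * Real.log η * P (y / η)| ≤
        Real.log ν * (|K| * sigmaHalf ν / Real.log (y / ν) ^ 6) := by
      intro η hη
      have hη0 : 0 < η := Nat.pos_of_mem_divisors hη
      have hην : (η : ℝ) ≤ ν := by
        exact_mod_cast Nat.le_of_dvd (Nat.pos_of_ne_zero hν0) (Nat.dvd_of_mem_divisors hη)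
      have hη1 : (1 : ℝ) ≤ η := by exact_mod_cast hη0
      have hyη : y / ν ≤ y / η := div_le_div_of_nonneg_left hy0 (by positivity) hην
      have hyη2 : 2 ≤ y / η := hyν2.trans hyη
      have hPb : |P (y / η)| ≤ |K| * sigmaHalf ν / Real.log (y / ν) ^ 6 := by
        refine (h24 ν hν1 (y / η) hyη2).trans ?_
        calc K * sigmaHalf ν / Real.log (y / η) ^ 6 ≤ |K| * sigmaHalf ν / Real.log (y / η) ^ 6 :=
              div_le_div_of_nonneg_right (mul_le_mul_of_nonneg_right (le_abs_self K) hσ)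
                (by positivity)
          _ ≤ |K| * sigmaHalf ν / Real.log (y / ν) ^ 6 := by
              refine div_le_div_of_nonneg_left (by positivity) (by positivity) ?_
              exact pow_le_pow_left₀ hlogyν.le (Real.log_le_log (by positivity) hyη) 6
      have hlogη : Real.log η ≤ Real.log ν := Real.log_le_log (by positivity) hην
      have hlogη0 : 0 ≤ Real.log η := Real.log_nonneg hη1
      have hμ : |(μ η : ℝ)| ≤ 1 := by exact_mod_cast ArithmeticFunction.abs_moebius_le_one
      rw [abs_mul, abs_mul, abs_of_nonneg hlogη0]
      calc |(μ η : ℝ)| * Real.log η * |P (y / η)|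
          ≤ 1 * Real.log ν * (|K| * sigmaHalf ν / Real.log (y / ν) ^ 6) :=
            mul_le_mul (mul_le_mul hμ hlogη hlogη0 zero_le_one) hPb (abs_nonneg _)
              (by positivity)
        _ = Real.log ν * (|K| * sigmaHalf ν / Real.log (y / ν) ^ 6) := by ring
    refine (Finset.sum_le_sum hterm).trans ?_
    rw [Finset.sum_const, nsmul_eq_mul]
  have hE2 : |∑ η ∈ ν.divisors, (μ η : ℝ) * (Q (y / η) - Q y)| ≤
      (ν.divisors.card : ℝ) * (3 * (|K| * sigmaHalf ν) / Real.log (y / ν) ^ 5) := by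
    refine (Finset.abs_sum_le_sum_abs _ _).trans ?_
    have hterm : ∀ η ∈ ν.divisors, |(μ η : ℝ) * (Q (y / η) - Q y)| ≤
        3 * (|K| * sigmaHalf ν) / Real.log (y / ν) ^ 5 := by
      intro η hη
      have hη0 : 0 < η := Nat.pos_of_mem_divisors hη
      have hην : (η : ℝ) ≤ ν := by
        exact_mod_cast Nat.le_of_dvd (Nat.pos_of_ne_zero hν0) (Nat.dvd_of_mem_divisors hη)
      have hη1 : (1 : ℝ) ≤ η := by exact_mod_cast hη0
      have hyη : y / ν ≤ y / η := div_le_div_of_nonneg_left hy0 (by positivity) hην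
      have hyηe : Real.exp 1 ≤ y / η := hyν.trans hyη
      have hyηy : y / η ≤ y := div_le_self hy0 hη1
      have htail := abs_sum_coprime_moebius_density_log_tail_le h24 hν1 hyηe hyηy
      have hμ : |(μ η : ℝ)| ≤ 1 := by exact_mod_cast ArithmeticFunction.abs_moebius_le_one
      rw [abs_mul, abs_sub_comm]
      calc |(μ η : ℝ)| * |Q y - Q (y / η)| ≤ 1 * (3 * (|K| * sigmaHalf ν) / Real.log (y / η) ^ 5) :=
            mul_le_mul hμ htail (abs_nonneg _) zero_le_one
        _ ≤ 3 * (|K| * sigmaHalf ν) / Real.log (y / ν) ^ 5 := by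
            rw [one_mul]
            refine div_le_div_of_nonneg_left (by positivity) (by positivity) ?_
            exact pow_le_pow_left₀ hlogyν.le (Real.log_le_log (by positivity) hyη) 5
    refine (Finset.sum_le_sum hterm).trans ?_
    rw [Finset.sum_const, nsmul_eq_mul]
  calc |(∑ η ∈ ν.divisors, (μ η : ℝ) * Real.log η * P (y / η)) +
        ∑ η ∈ ν.divisors, (μ η : ℝ) * (Q (y / η) - Q y)|
      ≤ |∑ η ∈ ν.divisors, (μ η : ℝ) * Real.log η * P (y / η)| +
          |∑ η ∈ ν.divisors, (μ η : ℝ) * (Q (y / η) - Q y)| := abs_add_le _ _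
    _ ≤ (ν.divisors.card : ℝ) * (Real.log ν * (|K| * sigmaHalf ν / Real.log (y / ν) ^ 6)) +
          (ν.divisors.card : ℝ) * (3 * (|K| * sigmaHalf ν) / Real.log (y / ν) ^ 5) :=
        add_le_add hE1 hE2
    _ = (ν.divisors.card : ℝ) * (|K| * sigmaHalf ν) *
          (Real.log ν / Real.log (y / ν) ^ 6 + 3 / Real.log (y / ν) ^ 5) := by ring

/-! ### `T(x; y)` unfolded: `V_b(t) = ∑_ν λ_ν A_{[b,ν]}(t)`, main terms and remainder terms -/

section Unfold

variable {A : SieveSequence} {D δ Δ : ℝ → ℝ}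

/-- `A_d(t) = 0` when `d > ⌊t⌋`. [folklore] -/
theorem SieveSequence.congrSum_eq_zero_of_floor_lt (A : SieveSequence) {d : ℕ} {t : ℝ}
    (hd : ⌊t⌋₊ < d) : A.congrSum d t = 0 := by
  unfold SieveSequence.congrSum
  refine Finset.sum_eq_zero fun n hn => ?_
  obtain ⟨hn, hdn⟩ := Finset.mem_filter.mp hn
  obtain ⟨hn0, hnt⟩ := Finset.mem_Ioc.mp hn
  exact absurd ((Nat.le_of_dvd hn0 hdn).trans hnt) (not_le.mpr hd)

/-- **The `ν`-range in `V_m(t) = ∑_ν λ_ν A_{[m,ν]}(t)`** may be taken to be `ν ≤ L`, the level,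
for every `t` (for `ν > t` the congruence sum is empty, for `ν > L` the weight vanishes).
[cite: FriedlanderIwaniecASP1998, §4 (4.3)] -/
theorem IsUpperSieveWeights.sum_lam_congrSum_lcm_eq {P L : ℝ} {lam : ℕ → ℤ}
    (hw : IsUpperSieveWeights P L lam) (A : SieveSequence) (m : ℕ) (t : ℝ) (hL : 0 ≤ L) :
    ∑ ν ∈ Icc 1 ⌊t⌋₊, (lam ν : ℝ) * A.congrSum (Nat.lcm m ν) t =
      ∑ ν ∈ Icc 1 ⌊L⌋₊, (lam ν : ℝ) * A.congrSum (Nat.lcm m ν) t := by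
  set M := max ⌊t⌋₊ ⌊L⌋₊ with hM
  have hl : ∑ ν ∈ Icc 1 ⌊t⌋₊, (lam ν : ℝ) * A.congrSum (Nat.lcm m ν) t =
      ∑ ν ∈ Icc 1 M, (lam ν : ℝ) * A.congrSum (Nat.lcm m ν) t := by
    refine Finset.sum_subset (Finset.Icc_subset_Icc_right (le_max_left _ _)) fun ν hνM hνt => ?_
    have hν1 : 1 ≤ ν := (Finset.mem_Icc.mp hνM).1
    have hlt : ⌊t⌋₊ < ν := by
      by_contra hcon
      exact hνt (Finset.mem_Icc.mpr ⟨hν1, not_lt.mp hcon⟩)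
    rw [SieveSequence.congrSum]
    rw [Finset.sum_eq_zero, mul_zero]
    intro n hn
    obtain ⟨hn, hdn⟩ := Finset.mem_filter.mp hn
    obtain ⟨hn0, hnt⟩ := Finset.mem_Ioc.mp hn
    have hνn : ν ∣ n := dvd_trans (Nat.dvd_lcm_right m ν) hdn
    exact absurd ((Nat.le_of_dvd hn0 hνn).trans hnt) (not_le.mpr hlt)
  have hr : ∑ ν ∈ Icc 1 ⌊L⌋₊, (lam ν : ℝ) * A.congrSum (Nat.lcm m ν) t =
      ∑ ν ∈ Icc 1 M, (lam ν : ℝ) * A.congrSum (Nat.lcm m ν) t := by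
    refine Finset.sum_subset (Finset.Icc_subset_Icc_right (le_max_right _ _)) fun ν hνM hνL => ?_
    have hν1 : 1 ≤ ν := (Finset.mem_Icc.mp hνM).1
    have hlt : L < ν := by
      have : ⌊L⌋₊ < ν := by
        by_contra hcon
        exact hνL (Finset.mem_Icc.mpr ⟨hν1, not_lt.mp hcon⟩)
      exact (Nat.floor_lt hL).mp this
    rw [hw.eq_zero_of_lt hlt, Int.cast_zero, zero_mul]
  rw [hl, hr]

/-- Restricting `∑_b f(b ≤ y) V_b(t)` over `b ≤ t` to `b ≤ ⌊y⌋` for every `t` (for `b > t`,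
`V_b(t) = ∑_{n ≤ t, b ∣ n} a_n ρ_n` is empty). [folklore] -/
theorem SieveSequence.sum_Icc_floor_truncLE_mul_eq (A : SieveSequence) (lam : ℕ → ℤ)
    (f : ArithmeticFunction ℝ) {y : ℝ} (hy : 0 ≤ y) (t : ℝ) :
    ∑ b ∈ Icc 1 ⌊t⌋₊, truncLE f y b *
        (∑ n ∈ (Icc 1 ⌊t⌋₊).filter (b ∣ ·), A.a n * (sieveRho lam n : ℝ)) =
      ∑ b ∈ Icc 1 ⌊y⌋₊, f b *
        (∑ n ∈ (Icc 1 ⌊t⌋₊).filter (b ∣ ·), A.a n * (sieveRho lam n : ℝ)) := by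
  set V : ℕ → ℝ := fun b => ∑ n ∈ (Icc 1 ⌊t⌋₊).filter (b ∣ ·), A.a n * (sieveRho lam n : ℝ)
    with hV
  have hV0 : ∀ b : ℕ, ⌊t⌋₊ < b → V b = 0 := by
    intro b hb
    refine Finset.sum_eq_zero fun n hn => ?_
    obtain ⟨hn, hbn⟩ := Finset.mem_filter.mp hn
    obtain ⟨hn1, hnt⟩ := Finset.mem_Icc.mp hn
    exact absurd ((Nat.le_of_dvd hn1 hbn).trans hnt) (not_le.mpr hb)
  set M := max ⌊t⌋₊ ⌊y⌋₊ with hM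
  have hl : ∑ b ∈ Icc 1 ⌊t⌋₊, truncLE f y b * V b = ∑ b ∈ Icc 1 M, truncLE f y b * V b := by
    refine Finset.sum_subset (Finset.Icc_subset_Icc_right (le_max_left _ _)) fun b hbM hbt => ?_
    have hb1 : 1 ≤ b := (Finset.mem_Icc.mp hbM).1
    have hlt : ⌊t⌋₊ < b := by
      by_contra hcon
      exact hbt (Finset.mem_Icc.mpr ⟨hb1, not_lt.mp hcon⟩)
    rw [hV0 b hlt, mul_zero]
  have hr : ∑ b ∈ Icc 1 ⌊y⌋₊, f b * V b = ∑ b ∈ Icc 1 M, truncLE f y b * V b := by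
    calc ∑ b ∈ Icc 1 ⌊y⌋₊, f b * V b = ∑ b ∈ Icc 1 ⌊y⌋₊, truncLE f y b * V b := by
          refine Finset.sum_congr rfl fun b hb => ?_
          have hby : (b : ℝ) ≤ y := (Nat.le_floor_iff hy).mp (Finset.mem_Icc.mp hb).2
          rw [truncLE_apply, if_pos hby]
      _ = ∑ b ∈ Icc 1 M, truncLE f y b * V b := by
          refine Finset.sum_subset (Finset.Icc_subset_Icc_right (le_max_right _ _))
            fun b hbM hby => ?_
          have hb1 : 1 ≤ b := (Finset.mem_Icc.mp hbM).1
          have hby' : ¬(b : ℝ) ≤ y := fun h' => hby (Finset.mem_Icc.mpr ⟨hb1, Nat.le_floor h'⟩)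
          rw [truncLE_apply, if_neg hby', zero_mul]
  rw [hl, hr]

/-- **`∑_{n ≤ t} a_n ρ_n (f(· ≤ y) * 1)(n) = ∑_{b ≤ y} f(b) V_b(t)`**, `V_b(t) = ∑_{n ≤ t, b ∣ n}
a_n ρ_n` (FI (4.1), second line, with a general `f` in place of `μ`; valid for every `t`).
[cite: FriedlanderIwaniecASP1998, §4 (4.1)] -/
theorem SieveSequence.rhoSum_truncLE_mul_zeta (A : SieveSequence) (lam : ℕ → ℤ)
    (f : ArithmeticFunction ℝ) {y : ℝ} (hy : 0 ≤ y) (t : ℝ) :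
    A.rhoSum lam (truncLE f y * ζ) t =
      ∑ b ∈ Icc 1 ⌊y⌋₊, f b *
        (∑ n ∈ (Icc 1 ⌊t⌋₊).filter (b ∣ ·), A.a n * (sieveRho lam n : ℝ)) := by
  have h1 : truncLE f y * (ζ : ArithmeticFunction ℝ) = truncLE f y * 1 * ζ := by rw [mul_one]
  rw [h1, A.rhoSum_mul_mul_zeta lam (truncLE f y) 1 t]
  have h2 : ∀ b ∈ Icc 1 ⌊t⌋₊, ∑ c ∈ Icc 1 ⌊t⌋₊, truncLE f y b * (1 : ArithmeticFunction ℝ) c *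
      (∑ n ∈ (Icc 1 ⌊t⌋₊).filter (b * c ∣ ·), A.a n * (sieveRho lam n : ℝ)) =
      truncLE f y b * (∑ n ∈ (Icc 1 ⌊t⌋₊).filter (b ∣ ·), A.a n * (sieveRho lam n : ℝ)) := by
    intro b hb
    obtain ⟨hb1, hbt⟩ := Finset.mem_Icc.mp hb
    have h1mem : 1 ∈ Icc 1 ⌊t⌋₊ := Finset.mem_Icc.mpr ⟨le_rfl, hb1.trans hbt⟩
    rw [Finset.sum_eq_single_of_mem 1 h1mem]
    · rw [ArithmeticFunction.one_one, mul_one, mul_one]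
    · intro c _ hc1
      rw [ArithmeticFunction.one_apply, if_neg hc1, mul_zero, zero_mul]
  rw [Finset.sum_congr rfl h2]
  exact A.sum_Icc_floor_truncLE_mul_eq lam f hy t

/-- **`V_b(t) = ∑_{ν ≤ L} λ_ν A_{[b,ν]}(t)`** (FI (4.3), for weights of level `L ≥ 0` and every
`t`). [cite: FriedlanderIwaniecASP1998, §4 (4.3)] -/
theorem IsUpperSieveWeights.sum_filter_dvd_a_mul_sieveRho_eq {P L : ℝ} {lam : ℕ → ℤ}
    (hw : IsUpperSieveWeights P L lam) (A : SieveSequence) (b : ℕ) (t : ℝ) (hL : 0 ≤ L) :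
    (∑ n ∈ (Icc 1 ⌊t⌋₊).filter (b ∣ ·), A.a n * (sieveRho lam n : ℝ)) =
      ∑ ν ∈ Icc 1 ⌊L⌋₊, (lam ν : ℝ) * A.congrSum (Nat.lcm b ν) t := by
  rw [A.sum_a_mul_sieveRho_eq_sum_congrSum lam b t, hw.sum_lam_congrSum_lcm_eq A b t hL]

/-- **Leibniz rule for `log` against Dirichlet convolution**: `f * log + (f · log) * 1 = (f * 1) · log`
(pointwise products `·`; i.e. `∑_{bc = n} f(b) log c = log n ∑_{b ∣ n} f(b) - ∑_{b ∣ n} f(b) log b`,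
the splitting "`log nb = log n - log b`" [sic] `T = T₁ + T₂` of FI §4). [cite: FriedlanderIwaniecASP1998, §4 (4.1)] -/
theorem ArithmeticFunction.mul_log_add_pmul_log_mul_zeta (f : ArithmeticFunction ℝ) :
    f * ArithmeticFunction.log + f.pmul ArithmeticFunction.log * ζ =
      (f * ζ).pmul ArithmeticFunction.log := by
  ext n
  simp only [ArithmeticFunction.add_apply, ArithmeticFunction.coe_mul_zeta_apply,
    ArithmeticFunction.pmul_apply, ArithmeticFunction.log_apply]
  rw [ArithmeticFunction.mul_apply,
    Nat.sum_divisorsAntidiagonal (fun a b => f a * ArithmeticFunction.log b)]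
  simp only [ArithmeticFunction.log_apply]
  rw [Finset.sum_mul, ← Finset.sum_add_distrib]
  refine Finset.sum_congr rfl fun d hd => ?_
  have hn0 : n ≠ 0 := (Nat.mem_divisors.mp hd).2
  have hdn : d ∣ n := Nat.dvd_of_mem_divisors hd
  have hd0 : d ≠ 0 := ne_zero_of_dvd_ne_zero hn0 hdn
  rw [Nat.cast_div hdn (by exact_mod_cast hd0),
    Real.log_div (by exact_mod_cast hn0) (by exact_mod_cast hd0)]
  ring

/-- `(f · log)(b ≤ y) = f(b ≤ y) · log`. [folklore] -/
theorem truncLE_pmul_log (f : ArithmeticFunction ℝ) (y : ℝ) :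
    truncLE (f.pmul ArithmeticFunction.log) y = (truncLE f y).pmul ArithmeticFunction.log := by
  ext b
  simp only [truncLE_apply, ArithmeticFunction.pmul_apply]
  split_ifs <;> simp

/-- **`T(x; y) = T₁(x; y) + T₂(x; y)`** (FI §4, first display and (4.1)):
`T(x; y) = ∑_{n ≤ x} (a_n ρ_n M_y(n)) log n - ∑_{b ≤ y} μ(b) log b · V_b(x)` with
`M_y(n) = ∑_{b ∣ n, b ≤ y} μ(b) = (μ(· ≤ y) * 1)(n)` and `V_b(x) = ∑_{n ≤ x, b ∣ n} a_n ρ_n`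
(`0 ≤ y`). [cite: FriedlanderIwaniecASP1998, §4 (4.1)] -/
theorem SieveSequence.fiT_eq_T1_sub_T2 (A : SieveSequence) (lam : ℕ → ℤ) {x y : ℝ} (hy : 0 ≤ y) :
    A.fiT lam x y =
      (∑ n ∈ Icc 1 ⌊x⌋₊, (A.a n * (sieveRho lam n : ℝ) *
          (truncLE (μ : ArithmeticFunction ℝ) y * ζ) n) * Real.log n) -
      ∑ b ∈ Icc 1 ⌊y⌋₊, (μ b : ℝ) * Real.log b *
        (∑ n ∈ (Icc 1 ⌊x⌋₊).filter (b ∣ ·), A.a n * (sieveRho lam n : ℝ)) := by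
  rw [SieveSequence.fiT, eq_sub_iff_add_eq]
  have h := ArithmeticFunction.mul_log_add_pmul_log_mul_zeta (truncLE (μ : ArithmeticFunction ℝ) y)
  have h2 : A.rhoSum lam (truncLE (μ : ArithmeticFunction ℝ) y * ArithmeticFunction.log) x +
      A.rhoSum lam ((truncLE (μ : ArithmeticFunction ℝ) y).pmul ArithmeticFunction.log * ζ) x =
      A.rhoSum lam ((truncLE (μ : ArithmeticFunction ℝ) y * ζ).pmul ArithmeticFunction.log) x := by
    rw [← SieveSequence.rhoSum_add, h]
  have hT1 : A.rhoSum lam ((truncLE (μ : ArithmeticFunction ℝ) y * ζ).pmul ArithmeticFunction.log) x =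
      ∑ n ∈ Icc 1 ⌊x⌋₊, (A.a n * (sieveRho lam n : ℝ) *
        (truncLE (μ : ArithmeticFunction ℝ) y * ζ) n) * Real.log n := by
    rw [SieveSequence.rhoSum]
    refine Finset.sum_congr rfl fun n _ => ?_
    rw [ArithmeticFunction.pmul_apply, ArithmeticFunction.log_apply]
    ring
  have hT2 : A.rhoSum lam ((truncLE (μ : ArithmeticFunction ℝ) y).pmul ArithmeticFunction.log * ζ) x =
      ∑ b ∈ Icc 1 ⌊y⌋₊, (μ b : ℝ) * Real.log b *
        (∑ n ∈ (Icc 1 ⌊x⌋₊).filter (b ∣ ·), A.a n * (sieveRho lam n : ℝ)) := by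
    rw [← truncLE_pmul_log, A.rhoSum_truncLE_mul_zeta lam _ hy x]
    refine Finset.sum_congr rfl fun b _ => ?_
    rw [ArithmeticFunction.pmul_apply, ArithmeticFunction.log_apply, ArithmeticFunction.intCoe_apply]
  rw [← hT1, ← h2, hT2]

/-- **Inserting (1.7) into `∑_b φ(b) V_b(t)`** (FI §4: "We insert the approximation (1.7) for
`A_{[ν,b]}(x)`"; only squarefree moduli occur by (1.16)): for weights of level `L ≥ 0`, `y ≥ 0`
and any `φ`, `∑_{b ≤ y} φ(b) V_b(t) = A(t) ∑_{b ≤ y} ∑_{ν ≤ L} [sqf] φ(b) λ_ν g([b,ν])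
+ ∑_{b ≤ y} ∑_{ν ≤ L} [sqf] φ(b) λ_ν r_{[b,ν]}(t)`. [cite: FriedlanderIwaniecASP1998, §4 (4.3)] -/
theorem SieveSequence.FIAsymptoticSieveHypotheses.sum_phi_V_eq_main_add_rem
    (h : A.FIAsymptoticSieveHypotheses D δ Δ) {P L : ℝ} {lam : ℕ → ℤ}
    (hw : IsUpperSieveWeights P L lam) (hL : 0 ≤ L) (φ : ℕ → ℝ) (By : ℕ) (t : ℝ) :
    ∑ b ∈ Icc 1 By, φ b * (∑ n ∈ (Icc 1 ⌊t⌋₊).filter (b ∣ ·), A.a n * (sieveRho lam n : ℝ)) =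
      A.size t * (∑ b ∈ Icc 1 By, ∑ ν ∈ Icc 1 ⌊L⌋₊,
        if Squarefree (Nat.lcm b ν) then φ b * (lam ν : ℝ) * A.density (Nat.lcm b ν) else 0)
      + ∑ b ∈ Icc 1 By, ∑ ν ∈ Icc 1 ⌊L⌋₊,
        if Squarefree (Nat.lcm b ν) then φ b * (lam ν : ℝ) * A.remainder (Nat.lcm b ν) t else 0 := by
  rw [Finset.mul_sum, ← Finset.sum_add_distrib]
  refine Finset.sum_congr rfl fun b _ => ?_
  rw [hw.sum_filter_dvd_a_mul_sieveRho_eq A b t hL, Finset.mul_sum, Finset.mul_sum,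
    ← Finset.sum_add_distrib]
  refine Finset.sum_congr rfl fun ν _ => ?_
  split_ifs with hsq
  · rw [SieveSequence.congrSum_eq_density_mul_size_add_remainder]; ring
  · rw [h.congrSum_eq_zero_of_not_squarefree hsq]; ring

/-- Fiber count for pairs: `#{(b, ν) ∈ J : [b, ν] = d} ≤ τ(d)²` (`d ≠ 0`). [folklore] -/
theorem card_filter_lcm_eq_le_sq {d : ℕ} (hd : d ≠ 0) (J : Finset (ℕ × ℕ)) :
    (J.filter (fun j : ℕ × ℕ => Nat.lcm j.1 j.2 = d)).card ≤ d.divisors.card ^ 2 := by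
  calc (J.filter (fun j : ℕ × ℕ => Nat.lcm j.1 j.2 = d)).card ≤ (d.divisors ×ˢ d.divisors).card := by
        refine Finset.card_le_card fun j hj => ?_
        obtain ⟨-, hjd⟩ := Finset.mem_filter.mp hj
        refine Finset.mem_product.mpr ⟨Nat.mem_divisors.mpr ⟨?_, hd⟩, Nat.mem_divisors.mpr ⟨?_, hd⟩⟩
        · rw [← hjd]; exact Nat.dvd_lcm_left _ _
        · rw [← hjd]; exact Nat.dvd_lcm_right _ _
    _ = d.divisors.card ^ 2 := by rw [Finset.card_product, sq]

/-- **The remainder terms** (FI §4: "The remainder terms in (4.3) make a contribution to (4.1)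
which is `≪ (log x) ∑_ν ∑_b |λ_ν μ(b) r_{[ν,b]}(x)| ≪ (log x) ∑^♭_{d < Δy} τ₃(d)|r_d(x)|`"): for a
box `b ≤ B_y`, `ν ≤ N_L` with `B_y N_L ≤ D`, `|λ_ν| ≤ 1` and `|φ(b)| ≤ Φ`,
`|∑_b ∑_ν [sqf] φ(b) λ_ν r_{[b,ν]}(t)| ≤ Φ ∑_{d ≤ D sqfree} τ₅(d) |r_d(t)|` (`τ(d)² ≤ τ₅(d)`).
[cite: FriedlanderIwaniecASP1998, §4 p. 1053] -/
theorem SieveSequence.abs_pairRemTerms_le (A : SieveSequence) {lam : ℕ → ℤ}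
    (hlam : ∀ ν, |lam ν| ≤ 1) {φ : ℕ → ℝ} {Φ : ℝ} (hΦ : 0 ≤ Φ) {By NL : ℕ}
    (hφ : ∀ b ∈ Icc 1 By, |φ b| ≤ Φ) {Dx : ℝ} (hbox : ((By * NL : ℕ) : ℝ) ≤ Dx) (t : ℝ) :
    |∑ b ∈ Icc 1 By, ∑ ν ∈ Icc 1 NL,
        (if Squarefree (Nat.lcm b ν) then φ b * (lam ν : ℝ) * A.remainder (Nat.lcm b ν) t else 0)| ≤
      Φ * ∑ d ∈ (Icc 1 ⌊Dx⌋₊).filter Squarefree, (divisorCountK 5 d : ℝ) * |A.remainder d t| := by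
  classical
  set Box := (Icc 1 By) ×ˢ (Icc 1 NL) with hBox
  set ψ : ℕ × ℕ → ℕ := fun j => Nat.lcm j.1 j.2 with hψ
  set J := Box.filter (fun j => Squarefree (ψ j)) with hJ
  set S := (Icc 1 ⌊Dx⌋₊).filter Squarefree with hS
  -- pass to the box and take absolute values inside
  have h1 : |∑ b ∈ Icc 1 By, ∑ ν ∈ Icc 1 NL,
        (if Squarefree (Nat.lcm b ν) then φ b * (lam ν : ℝ) * A.remainder (Nat.lcm b ν) t else 0)| ≤
      ∑ j ∈ J, Φ * |A.remainder (ψ j) t| := by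
    have hprod : ∑ b ∈ Icc 1 By, ∑ ν ∈ Icc 1 NL,
        (if Squarefree (Nat.lcm b ν) then φ b * (lam ν : ℝ) * A.remainder (Nat.lcm b ν) t else 0) =
        ∑ j ∈ Box, (if Squarefree (ψ j) then φ j.1 * (lam j.2 : ℝ) * A.remainder (ψ j) t else 0) := by
      rw [Finset.sum_product]
    rw [hprod, hJ, Finset.sum_filter]
    refine (Finset.abs_sum_le_sum_abs _ _).trans (Finset.sum_le_sum fun j hj => ?_)
    obtain ⟨hb, -⟩ := Finset.mem_product.mp hj
    split_ifs with hsq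
    · rw [abs_mul, abs_mul]
      have hl : |(lam j.2 : ℝ)| ≤ 1 := by exact_mod_cast hlam j.2
      calc |φ j.1| * |(lam j.2 : ℝ)| * |A.remainder (ψ j) t| ≤ Φ * 1 * |A.remainder (ψ j) t| := by
            gcongr
            exact hφ j.1 hb
        _ = Φ * |A.remainder (ψ j) t| := by ring
    · simp
  refine h1.trans ?_
  -- `ψ` maps `J` into `S`
  have hmaps : ∀ j ∈ J, ψ j ∈ S := by
    rintro ⟨b, ν⟩ hj
    obtain ⟨hjB, hsq⟩ := Finset.mem_filter.mp hj
    simp only [hBox, Finset.mem_product, Finset.mem_Icc] at hjB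
    obtain ⟨⟨hb1, hbB⟩, ⟨hν1, hνN⟩⟩ := hjB
    have hpos : 0 < Nat.lcm b ν := Nat.lcm_pos hb1 hν1
    refine Finset.mem_filter.mpr ⟨Finset.mem_Icc.mpr ⟨hpos, Nat.le_floor ?_⟩, hsq⟩
    have hle : Nat.lcm b ν ≤ b * ν := by
      rw [Nat.lcm_eq_mul_div]
      exact Nat.div_le_self _ _
    have hle' : b * ν ≤ By * NL := Nat.mul_le_mul hbB hνN
    calc ((Nat.lcm b ν : ℕ) : ℝ) ≤ ((By * NL : ℕ) : ℝ) := by exact_mod_cast hle.trans hle'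
      _ ≤ Dx := hbox
  rw [← Finset.sum_fiberwise_of_maps_to hmaps, Finset.mul_sum]
  refine Finset.sum_le_sum fun d hd => ?_
  obtain ⟨hd1, hdsq⟩ := Finset.mem_filter.mp hd
  have hd0 : d ≠ 0 := by have := (Finset.mem_Icc.mp hd1).1; omega
  have hfib : ∑ j ∈ J.filter (fun j => ψ j = d), Φ * |A.remainder (ψ j) t| =
      ((J.filter (fun j => ψ j = d)).card : ℝ) * (Φ * |A.remainder d t|) := by
    rw [Finset.sum_congr rfl fun j hj => by rw [(Finset.mem_filter.mp hj).2], Finset.sum_const,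
      nsmul_eq_mul]
  rw [hfib]
  have hcard : ((J.filter (fun j => ψ j = d)).card : ℝ) ≤ (divisorCountK 5 d : ℝ) := by
    calc ((J.filter (fun j => ψ j = d)).card : ℝ) ≤ ((d.divisors.card : ℝ)) ^ 2 := by
          exact_mod_cast card_filter_lcm_eq_le_sq hd0 J
      _ ≤ (divisorCountK 5 d : ℝ) := card_divisors_sq_le_divisorCountK_five hdsq
  calc ((J.filter (fun j => ψ j = d)).card : ℝ) * (Φ * |A.remainder d t|)
      ≤ (divisorCountK 5 d : ℝ) * (Φ * |A.remainder d t|) :=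
        mul_le_mul_of_nonneg_right hcard (by positivity)
    _ = Φ * ((divisorCountK 5 d : ℝ) * |A.remainder d t|) := by ring

/-- **The summands of the main terms** (FI §4: only squarefree `[b, ν]` occur and then
`g([ν, b]) = g(ν) g(b/(ν, b))`): pointwise, for `ν ≥ 1`,
`[[b,ν] sqfree] φ(b) λ_ν g([b,ν]) = [ν sqfree ∧ b sqfree] λ_ν g(ν) · φ(b) g(b/(b,ν))`.
[cite: FriedlanderIwaniecASP1998, §4 (4.3)] -/
theorem fi_pairMainTerm_pointwise {g : ArithmeticFunction ℝ} (hg : g.IsMultiplicative) (lamν φb : ℝ)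
    {b ν : ℕ} (hν : ν ≠ 0) :
    (if Squarefree (Nat.lcm b ν) then φb * lamν * g (Nat.lcm b ν) else 0) =
      if Squarefree ν ∧ Squarefree b then lamν * g ν * (φb * g (b / Nat.gcd b ν)) else 0 := by
  by_cases hb : Squarefree b
  · by_cases hνs : Squarefree ν
    · rw [if_pos ((squarefree_lcm_iff_of_squarefree hb hν).mpr hνs), if_pos ⟨hνs, hb⟩,
        ArithmeticFunction.IsMultiplicative.map_lcm_of_squarefree hg hb hν]
      ring
    · rw [if_neg (fun h => hνs ((squarefree_lcm_iff_of_squarefree hb hν).mp h)),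
        if_neg (fun h => hνs h.1)]
  · rw [if_neg (fun h => hb (Squarefree.of_lcm_left h)), if_neg (fun h => hb h.2)]

/-- **The main terms rearranged** (FI §4, display after (4.3), summed against `λ_ν g(ν)`):
`∑_b ∑_ν [sqf] φ(b) λ_ν g([b,ν]) = ∑_{ν sqfree} λ_ν g(ν) ∑_{b sqfree} φ(b) g(b/(b,ν))`.
[cite: FriedlanderIwaniecASP1998, §4 (4.3)] -/
theorem fi_pairMainTerms_eq {g : ArithmeticFunction ℝ} (hg : g.IsMultiplicative) (lam : ℕ → ℤ)
    (φ : ℕ → ℝ) (By NL : ℕ) :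
    ∑ b ∈ Icc 1 By, ∑ ν ∈ Icc 1 NL,
        (if Squarefree (Nat.lcm b ν) then φ b * (lam ν : ℝ) * g (Nat.lcm b ν) else 0) =
      ∑ ν ∈ (Icc 1 NL).filter Squarefree, (lam ν : ℝ) * g ν *
        ∑ b ∈ (Icc 1 By).filter Squarefree, φ b * g (b / Nat.gcd b ν) := by
  rw [Finset.sum_comm, Finset.sum_filter]
  refine Finset.sum_congr rfl fun ν hν => ?_
  have hν0 : ν ≠ 0 := by have := (Finset.mem_Icc.mp hν).1; omega
  split_ifs with hνs
  · rw [Finset.sum_filter, Finset.mul_sum]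
    refine Finset.sum_congr rfl fun b _ => ?_
    rw [fi_pairMainTerm_pointwise hg _ _ hν0]
    by_cases hb : Squarefree b
    · rw [if_pos ⟨hνs, hb⟩, if_pos hb]
    · rw [if_neg (fun h => hb h.2), if_neg hb, mul_zero]
  · refine Finset.sum_eq_zero fun b _ => ?_
    rw [fi_pairMainTerm_pointwise hg _ _ hν0, if_neg (fun h => hνs h.1)]

end Unfold


/-! ### Bounding the main terms -/

/-- **The main terms of `T₁(x; y)`** (FI §4: "the contribution to (4.1) coming from the main term
in (4.3) is `≪ A(x)(log x)^{-5} ∑_ν |λ_ν| g(ν) τ(ν) σ_ν ≪ A(x)(log x)^{-3}`"): for `|λ_ν| ≤ 1`,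
`L ≥ 2`, `y ≥ 2L`,
`|∑_{ν ≤ L sqf} λ_ν g(ν) ∑_{b ≤ y sqf} μ(b) g(b/(b,ν))| ≤ e^{2(|c₉|+|K₉|(log 2)^{-10}) + 6K'} (log ⌊L⌋)²
· |K₂₄| (log(y/L))^{-6}`. [cite: FriedlanderIwaniecASP1998, §4 p. 1053] -/
theorem abs_fi_T1_mainTerms_le {g : ArithmeticFunction ℝ} (hg : g.IsMultiplicative)
    {K c₉ K₉ K₂₄ : ℝ} (hK : ∀ p : ℕ, p.Prime → 0 ≤ g p ∧ g p < 1 ∧ g p ≤ K / p)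
    (h19 : ∀ y : ℝ, 2 ≤ y →
      |(∑ p ∈ Nat.primesLE ⌊y⌋₊, g p) - (Real.log (Real.log y) + c₉)| ≤ K₉ / Real.log y ^ 10)
    (h24 : ∀ ν : ℕ, 1 ≤ ν → ∀ y : ℝ, 2 ≤ y →
      |∑ d ∈ (Icc 1 ⌊y⌋₊).filter (fun d : ℕ => d.Coprime ν), (μ d : ℝ) * g d| ≤
        K₂₄ * sigmaHalf ν / Real.log y ^ 6)
    {lam : ℕ → ℤ} (hlam : ∀ ν, |lam ν| ≤ 1) {L y : ℝ} (hL : 2 ≤ L) (hyL : 2 * L ≤ y) :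
    |∑ ν ∈ (Icc 1 ⌊L⌋₊).filter Squarefree, (lam ν : ℝ) * g ν *
        ∑ b ∈ (Icc 1 ⌊y⌋₊).filter Squarefree, (μ b : ℝ) * g (b / Nat.gcd b ν)| ≤
      Real.exp (2 * (|c₉| + |K₉| / Real.log 2 ^ 10) + 6 * max K 0) * Real.log ⌊L⌋₊ ^ 2 *
        (|K₂₄| / Real.log (y / L) ^ 6) := by
  classical
  set M₀ := |K₂₄| / Real.log (y / L) ^ 6 with hM₀
  have hL0 : 0 < L := by linarith
  have hyL' : 2 ≤ y / L := by rw [le_div_iff₀ hL0]; linarith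
  have hlogyL : 0 < Real.log (y / L) := Real.log_pos (by linarith)
  have hM₀0 : 0 ≤ M₀ := div_nonneg (abs_nonneg _) (pow_nonneg hlogyL.le _)
  have hg0 : ∀ p : ℕ, p.Prime → 0 ≤ g p := fun p hp => (hK p hp).1
  have hLfloor : 2 ≤ ⌊L⌋₊ := Nat.le_floor (by exact_mod_cast hL)
  have hν_bound : ∀ ν ∈ (Icc 1 ⌊L⌋₊).filter Squarefree,
      |(lam ν : ℝ) * g ν * ∑ b ∈ (Icc 1 ⌊y⌋₊).filter Squarefree, (μ b : ℝ) * g (b / Nat.gcd b ν)| ≤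
      g ν * (ν.divisors.card : ℝ) * sigmaHalf ν * M₀ := by
    intro ν hν
    obtain ⟨hν1, hνs⟩ := Finset.mem_filter.mp hν
    obtain ⟨hν1', hνL⟩ := Finset.mem_Icc.mp hν1
    have hνL' : (ν : ℝ) ≤ L := (Nat.cast_le.mpr hνL).trans (Nat.floor_le hL0.le)
    have hν1r : (1 : ℝ) ≤ ν := by exact_mod_cast hν1'
    have hgν : 0 ≤ g ν := ArithmeticFunction.IsMultiplicative.nonneg_of_squarefree hg hg0 hνs
    have hσ : 0 ≤ sigmaHalf ν := zero_le_one.trans (one_le_sigmaHalf ν)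
    have hτ : 0 ≤ (ν.divisors.card : ℝ) := Nat.cast_nonneg _
    have h2ν : 2 * (ν : ℝ) ≤ y := by linarith
    have hb := abs_sum_moebius_density_div_gcd_le_one h24 hνs h2ν
    have hlogν : Real.log (y / L) ≤ Real.log (y / ν) :=
      Real.log_le_log (by linarith) (div_le_div_of_nonneg_left (by linarith) (by linarith) hνL')
    have hb' : |∑ b ∈ (Icc 1 ⌊y⌋₊).filter Squarefree, (μ b : ℝ) * g (b / Nat.gcd b ν)| ≤
        (ν.divisors.card : ℝ) * sigmaHalf ν * M₀ := by
      refine hb.trans ?_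
      rw [hM₀, mul_assoc]
      refine mul_le_mul_of_nonneg_left ?_ hτ
      calc |K₂₄| * sigmaHalf ν / Real.log (y / ν) ^ 6
          = sigmaHalf ν * (|K₂₄| / Real.log (y / ν) ^ 6) := by ring
        _ ≤ sigmaHalf ν * (|K₂₄| / Real.log (y / L) ^ 6) :=
          mul_le_mul_of_nonneg_left (div_le_div_of_nonneg_left (abs_nonneg _) (pow_pos hlogyL 6)
            (pow_le_pow_left₀ hlogyL.le hlogν 6)) hσ
    have hlamν : |(lam ν : ℝ)| ≤ 1 := by exact_mod_cast hlam ν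
    rw [abs_mul, abs_mul, abs_of_nonneg hgν]
    calc |(lam ν : ℝ)| * g ν * |∑ b ∈ (Icc 1 ⌊y⌋₊).filter Squarefree, (μ b : ℝ) * g (b / Nat.gcd b ν)|
        ≤ 1 * g ν * ((ν.divisors.card : ℝ) * sigmaHalf ν * M₀) :=
          mul_le_mul (mul_le_mul_of_nonneg_right hlamν hgν) hb' (abs_nonneg _)
            (mul_nonneg zero_le_one hgν)
      _ = g ν * (ν.divisors.card : ℝ) * sigmaHalf ν * M₀ := by ring
  have hE := sum_squarefree_density_card_sigmaHalf_le hg hK h19 hLfloor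
  calc |∑ ν ∈ (Icc 1 ⌊L⌋₊).filter Squarefree, (lam ν : ℝ) * g ν *
        ∑ b ∈ (Icc 1 ⌊y⌋₊).filter Squarefree, (μ b : ℝ) * g (b / Nat.gcd b ν)|
      ≤ ∑ ν ∈ (Icc 1 ⌊L⌋₊).filter Squarefree, g ν * (ν.divisors.card : ℝ) * sigmaHalf ν * M₀ :=
        (Finset.abs_sum_le_sum_abs _ _).trans (Finset.sum_le_sum hν_bound)
    _ = (∑ ν ∈ (Icc 1 ⌊L⌋₊).filter Squarefree, g ν * (ν.divisors.card : ℝ) * sigmaHalf ν) * M₀ := by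
        rw [Finset.sum_mul]
    _ ≤ Real.exp (2 * (|c₉| + |K₉| / Real.log 2 ^ 10) + 6 * max K 0) * Real.log ⌊L⌋₊ ^ 2 * M₀ :=
        mul_le_mul_of_nonneg_right hE hM₀0

/-- **The main terms of `T₂(x; y)`** (FI §4 (4.4) and p. 1054: the main term
`-A(x) ∑_ν λ_ν g(ν) ∑_{b ≤ y} μ(b) g(b/(ν,b)) log b` equals `HA(x) + O(A(x)(log x)^{-2})`; here
the finite form: the `ν`-sum differs from `∑_{b ≤ y} μ(b) g(b) log b` (the `ν = 1` term, `λ₁ = 1`)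
by `≤ e^{…} (log ⌊L⌋)² |K₂₄| (log L (log(y/L))^{-6} + 3 (log(y/L))^{-5})`), for `|λ_ν| ≤ 1`,
`λ₁ = 1`, `L ≥ 2`, `y ≥ eL`. [cite: FriedlanderIwaniecASP1998, §4 (4.4)] -/
theorem abs_fi_T2_mainTerms_sub_le {g : ArithmeticFunction ℝ} (hg : g.IsMultiplicative)
    {K c₉ K₉ K₂₄ : ℝ} (hK : ∀ p : ℕ, p.Prime → 0 ≤ g p ∧ g p < 1 ∧ g p ≤ K / p)
    (h19 : ∀ y : ℝ, 2 ≤ y →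
      |(∑ p ∈ Nat.primesLE ⌊y⌋₊, g p) - (Real.log (Real.log y) + c₉)| ≤ K₉ / Real.log y ^ 10)
    (h24 : ∀ ν : ℕ, 1 ≤ ν → ∀ y : ℝ, 2 ≤ y →
      |∑ d ∈ (Icc 1 ⌊y⌋₊).filter (fun d : ℕ => d.Coprime ν), (μ d : ℝ) * g d| ≤
        K₂₄ * sigmaHalf ν / Real.log y ^ 6)
    {lam : ℕ → ℤ} (hlam1 : lam 1 = 1) (hlam : ∀ ν, |lam ν| ≤ 1) {L y : ℝ} (hL : 2 ≤ L)
    (hyL : Real.exp 1 * L ≤ y) :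
    |(∑ ν ∈ (Icc 1 ⌊L⌋₊).filter Squarefree, (lam ν : ℝ) * g ν *
        ∑ b ∈ (Icc 1 ⌊y⌋₊).filter Squarefree, (μ b : ℝ) * g (b / Nat.gcd b ν) * Real.log b) -
        ∑ b ∈ Icc 1 ⌊y⌋₊, (μ b : ℝ) * g b * Real.log b| ≤
      Real.exp (2 * (|c₉| + |K₉| / Real.log 2 ^ 10) + 6 * max K 0) * Real.log ⌊L⌋₊ ^ 2 *
        (|K₂₄| * (Real.log L / Real.log (y / L) ^ 6 + 3 / Real.log (y / L) ^ 5)) := by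
  classical
  set M₀ := |K₂₄| * (Real.log L / Real.log (y / L) ^ 6 + 3 / Real.log (y / L) ^ 5) with hM₀
  set SL := (Icc 1 ⌊L⌋₊).filter Squarefree with hSL
  set F : ℕ → ℝ := fun ν =>
    ∑ b ∈ (Icc 1 ⌊y⌋₊).filter Squarefree, (μ b : ℝ) * g (b / Nat.gcd b ν) * Real.log b with hF
  set G : ℕ → ℝ := fun ν =>
    if ν = 1 then ∑ b ∈ Icc 1 ⌊y⌋₊, (μ b : ℝ) * g b * Real.log b else 0 with hG
  have he : (2 : ℝ) ≤ Real.exp 1 := by linarith [Real.add_one_le_exp (1 : ℝ)]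
  have he1 : (1 : ℝ) < Real.exp 1 := by linarith
  have hL0 : 0 < L := by linarith
  have hL1 : 1 ≤ L := by linarith
  have hyL' : Real.exp 1 ≤ y / L := by rw [le_div_iff₀ hL0]; linarith
  have hlogyL : 0 < Real.log (y / L) := Real.log_pos (by linarith)
  have hlogL : 0 ≤ Real.log L := Real.log_nonneg hL1
  have hM₀0 : 0 ≤ M₀ := by positivity
  have hg0 : ∀ p : ℕ, p.Prime → 0 ≤ g p := fun p hp => (hK p hp).1
  have hLfloor : 2 ≤ ⌊L⌋₊ := Nat.le_floor (by exact_mod_cast hL)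
  have h1mem : (1 : ℕ) ∈ SL :=
    Finset.mem_filter.mpr ⟨Finset.mem_Icc.mpr ⟨le_rfl, by omega⟩, squarefree_one⟩
  -- extract the `ν = 1` term
  have hG1 : ∑ ν ∈ SL, (lam ν : ℝ) * g ν * G ν = ∑ b ∈ Icc 1 ⌊y⌋₊, (μ b : ℝ) * g b * Real.log b := by
    simp only [hG, mul_ite, mul_zero]
    rw [Finset.sum_ite_eq' SL 1, if_pos h1mem, hlam1, hg.map_one]
    simp
  have hdiff : (∑ ν ∈ SL, (lam ν : ℝ) * g ν * F ν) - ∑ b ∈ Icc 1 ⌊y⌋₊, (μ b : ℝ) * g b * Real.log b =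
      ∑ ν ∈ SL, (lam ν : ℝ) * g ν * (F ν - G ν) := by
    rw [← hG1, ← Finset.sum_sub_distrib]
    exact Finset.sum_congr rfl fun ν _ => by ring
  rw [hdiff]
  have hν_bound : ∀ ν ∈ SL, |(lam ν : ℝ) * g ν * (F ν - G ν)| ≤
      g ν * (ν.divisors.card : ℝ) * sigmaHalf ν * M₀ := by
    intro ν hν
    obtain ⟨hν1, hνs⟩ := Finset.mem_filter.mp hν
    obtain ⟨hν1', hνL⟩ := Finset.mem_Icc.mp hν1
    have hνL' : (ν : ℝ) ≤ L := (Nat.cast_le.mpr hνL).trans (Nat.floor_le hL0.le)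
    have hν1r : (1 : ℝ) ≤ ν := by exact_mod_cast hν1'
    have hν0 : (0 : ℝ) < ν := by linarith
    have hgν : 0 ≤ g ν := ArithmeticFunction.IsMultiplicative.nonneg_of_squarefree hg hg0 hνs
    have hσ : 0 ≤ sigmaHalf ν := zero_le_one.trans (one_le_sigmaHalf ν)
    have hτ : 0 ≤ (ν.divisors.card : ℝ) := Nat.cast_nonneg _
    have heν : Real.exp 1 * ν ≤ y := by
      calc Real.exp 1 * ν ≤ Real.exp 1 * L := by gcongr
        _ ≤ y := hyL
    have hb := abs_sum_moebius_density_div_gcd_log_sub_le h24 hνs heν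
    have hy0 : 0 ≤ y := by
      have : 0 ≤ Real.exp 1 * L := by positivity
      linarith
    have hyν : y / L ≤ y / ν := div_le_div_of_nonneg_left hy0 hν0 hνL'
    have hlogν : Real.log (y / L) ≤ Real.log (y / ν) :=
      Real.log_le_log (lt_of_lt_of_le (by positivity) hyL') hyν
    have hlogνL : Real.log ν ≤ Real.log L := Real.log_le_log hν0 hνL'
    have hlogν0 : 0 ≤ Real.log ν := Real.log_nonneg hν1r
    have hb' : |F ν - G ν| ≤ (ν.divisors.card : ℝ) * sigmaHalf ν * M₀ := by
      refine hb.trans ?_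
      rw [hM₀]
      have h6 : Real.log ν / Real.log (y / ν) ^ 6 ≤ Real.log L / Real.log (y / L) ^ 6 := by
        calc Real.log ν / Real.log (y / ν) ^ 6 ≤ Real.log L / Real.log (y / ν) ^ 6 :=
              div_le_div_of_nonneg_right hlogνL (by positivity)
          _ ≤ Real.log L / Real.log (y / L) ^ 6 :=
              div_le_div_of_nonneg_left hlogL (pow_pos hlogyL 6) (pow_le_pow_left₀ hlogyL.le hlogν 6)
      have h5 : 3 / Real.log (y / ν) ^ 5 ≤ 3 / Real.log (y / L) ^ 5 :=
        div_le_div_of_nonneg_left (by norm_num) (pow_pos hlogyL 5)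
          (pow_le_pow_left₀ hlogyL.le hlogν 5)
      calc (ν.divisors.card : ℝ) * (|K₂₄| * sigmaHalf ν) *
            (Real.log ν / Real.log (y / ν) ^ 6 + 3 / Real.log (y / ν) ^ 5)
          ≤ (ν.divisors.card : ℝ) * (|K₂₄| * sigmaHalf ν) *
            (Real.log L / Real.log (y / L) ^ 6 + 3 / Real.log (y / L) ^ 5) :=
            mul_le_mul_of_nonneg_left (add_le_add h6 h5) (by positivity)
        _ = (ν.divisors.card : ℝ) * sigmaHalf ν *
            (|K₂₄| * (Real.log L / Real.log (y / L) ^ 6 + 3 / Real.log (y / L) ^ 5)) := by ring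
    have hlamν : |(lam ν : ℝ)| ≤ 1 := by exact_mod_cast hlam ν
    rw [abs_mul, abs_mul, abs_of_nonneg hgν]
    calc |(lam ν : ℝ)| * g ν * |F ν - G ν| ≤ 1 * g ν * ((ν.divisors.card : ℝ) * sigmaHalf ν * M₀) :=
          mul_le_mul (mul_le_mul_of_nonneg_right hlamν hgν) hb' (abs_nonneg _)
            (mul_nonneg zero_le_one hgν)
      _ = g ν * (ν.divisors.card : ℝ) * sigmaHalf ν * M₀ := by ring
  have hE := sum_squarefree_density_card_sigmaHalf_le hg hK h19 hLfloor
  calc |∑ ν ∈ SL, (lam ν : ℝ) * g ν * (F ν - G ν)|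
      ≤ ∑ ν ∈ SL, g ν * (ν.divisors.card : ℝ) * sigmaHalf ν * M₀ :=
        (Finset.abs_sum_le_sum_abs _ _).trans (Finset.sum_le_sum hν_bound)
    _ = (∑ ν ∈ SL, g ν * (ν.divisors.card : ℝ) * sigmaHalf ν) * M₀ := by rw [Finset.sum_mul]
    _ ≤ Real.exp (2 * (|c₉| + |K₉| / Real.log 2 ^ 10) + 6 * max K 0) * Real.log ⌊L⌋₊ ^ 2 * M₀ :=
        mul_le_mul_of_nonneg_right hE hM₀0


/-! ### The estimate (4.5) -/

/-- Elementary: `c A (log x)^{-k} ≤ c A (log x)^{-2}` for `c, A ≥ 0`, `log x ≥ 1`, `k ≥ 2`. [folklore] -/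
theorem mul_div_log_pow_le_of_two_le {c S l : ℝ} {k : ℕ} (hc : 0 ≤ c) (hS : 0 ≤ S) (hl : 1 ≤ l)
    (hk : 2 ≤ k) : c * S / l ^ k ≤ c * S / l ^ 2 :=
  div_le_div_of_nonneg_left (mul_nonneg hc hS) (by positivity) (pow_le_pow_right₀ hl hk)

/-- **FI (4.5) from (2.4) and (1.13)–(1.14)** (discharge of `fi_asp_T_estimate` modulo the
Möbius–density cancellation `fi_moebius_density_cancellation` = FI (2.4) and the logarithmic sum
`fi_moebius_density_log_sum` = FI (1.13)–(1.14), using the PROVED reduction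
`fi_reduced_remainder_bound_holds` = FI (R′)). FI §4: `T = T₁ + T₂` by `log(n/b) = log n - log b`;
`T₁(x; y) = ∑_{b ≤ y} μ(b) ∑_{n ≤ x, b ∣ n} a_n ρ_n log n` is treated by partial summation (4.2) from
`V_b(t) = ∑_ν λ_ν A_{[ν,b]}(t) = ∑_ν λ_ν (g([ν,b]) A(t) + r_{[ν,b]}(t))` (4.3), the main terms being
`≪ A(x)(log x)^{-5} ∑_ν |λ_ν| g(ν) τ(ν) σ_ν ≪ A(x)(log x)^{-3}` by (2.4) and the remainder terms
`≪ (log x) ∑^♭_{d < Δy} τ₃(d)|r_d(x)| ≪ A(x)(log x)^{-2}` by (R′) since `Δy < D`, so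
`T₁(x; y) ≪ A(x)(log x)^{-2}`; in `T₂(x; y) = -∑_{b ≤ y} μ(b) log b ∑_ν λ_ν A_{[ν,b]}(x)` the
remainder terms are treated in the same way and the main term (4.4)
`-A(x) ∑_ν λ_ν g(ν) ∑_{b ≤ y} μ(b) g(b/(ν,b)) log b` is `HA(x) + O(A(x)(log x)^{-2})` after
extending the summation to all `b` by (2.4) and evaluating the complete sum as `-H [ν = 1]`.
Here `Δ = x^{θ/2}`, `y ∈ [Y, eY]`, `Y = Δ⁻¹√D`, `0 < θ < 1/3` (`FIRegime`), so that `yΔ ≤ e√D ≤ D`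
and `log(y/Δ) ≥ (1/3 - θ) log x`. [cite: FriedlanderIwaniecASP1998, §4 (4.5)] -/
theorem fi_asp_T_estimate_of_cancellation (h24 : fi_moebius_density_cancellation)
    (h13 : fi_moebius_density_log_sum) : fi_asp_T_estimate := by
  intro A D α θ θ₁ lam H hreg hH
  classical
  have hhyp := hreg.hyp
  obtain ⟨K, hK⟩ := hhyp.2.2.2.1
  obtain ⟨c₉, K₉, h19⟩ := hhyp.2.2.2.2.1
  obtain ⟨K₂₄, h24'⟩ := h24 A.density A.density_mult ⟨K, hK⟩ ⟨c₉, K₉, h19⟩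
  have h13' := h13 A.density A.density_mult ⟨K, hK⟩ ⟨c₉, K₉, h19⟩ H hH
  obtain ⟨K_R, hR'⟩ := fi_reduced_remainder_bound_holds A D _ _ hhyp
  have hθ : 0 < θ := by linarith [hreg.θ₁_pos, hreg.θ₁_le]
  have hθ3 : θ < 1 / 3 := hreg.θ_lt
  set κ := 1 / 3 - θ with hκ
  have hκ0 : 0 < κ := by rw [hκ]; linarith
  set K' := max K 0 with hK'
  set KR := max K_R 0 with hKR
  set E := Real.exp (2 * (|c₉| + |K₉| / Real.log 2 ^ 10) + 6 * K') with hE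
  set C₁ := E * (|K₂₄| / κ ^ 6) with hC₁
  set C₂ := E * (|K₂₄| * (1 / κ ^ 6 + 3 / κ ^ 5)) with hC₂
  set C₃ := 3 * |K₂₄| / κ ^ 5 with hC₃
  have hK'0 : 0 ≤ K' := le_max_right _ _
  have hKR0 : 0 ≤ KR := le_max_right _ _
  have hE0 : 0 < E := Real.exp_pos _
  have hC₁0 : 0 ≤ C₁ := by positivity
  have hC₂0 : 0 ≤ C₂ := by positivity
  have hC₃0 : 0 ≤ C₃ := by positivity
  refine ⟨2 * (C₁ + KR) + C₂ + C₃ + KR, ?_⟩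
  have hR1 : ∀ᶠ x : ℝ in atTop, x ^ (2 / 3 : ℝ) < D x ∧ D x < x :=
    hhyp.2.2.2.2.2.2.1.mono fun x hx => ⟨hx.1, hx.2.1⟩
  filter_upwards [hreg.weights, hR', hR1, eventually_exp_mul_fiY_le_sqrt hθ hR1,
    eventually_ge_atTop (4 : ℝ), eventually_ge_atTop (Real.exp 1),
    (tendsto_rpow_atTop (half_pos hθ)).eventually_ge_atTop (Real.exp 2),
    (tendsto_rpow_atTop hκ0).eventually_ge_atTop (Real.exp 1),
    (tendsto_rpow_atTop (show (0 : ℝ) < 1 / 3 by norm_num)).eventually_ge_atTop (Real.exp 2)]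
    with x hw hRx hR1x heY hx4 hxe hxθ hxκ hx13
  intro y hYy hyY
  -- elementary facts about the parameters
  have he : (2 : ℝ) ≤ Real.exp 1 := by linarith [Real.add_one_le_exp (1 : ℝ)]
  have he12 : Real.exp 1 ≤ Real.exp 2 := Real.exp_le_exp.mpr (by norm_num)
  have hx0 : 0 < x := by linarith
  have hx1 : 1 ≤ x := by linarith
  have hlogx : 1 ≤ Real.log x := by rw [Real.le_log_iff_exp_le hx0]; exact hxe
  have hlogx0 : 0 < Real.log x := by linarith
  have hD0 : 0 < D x := lt_trans (by positivity) hR1x.1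
  set L := x ^ (θ / 2) with hLdef
  have hL0 : 0 < L := Real.rpow_pos_of_pos hx0 _
  have he2 : (2 : ℝ) ≤ Real.exp 2 := by linarith [Real.add_one_le_exp (2 : ℝ)]
  have hL2 : 2 ≤ L := he2.trans hxθ
  have hL1 : 1 ≤ L := by linarith
  have hLx : L ≤ x := by
    calc L = x ^ (θ / 2) := rfl
      _ ≤ x ^ (1 : ℝ) := Real.rpow_le_rpow_of_exponent_le hx1 (by linarith)
      _ = x := Real.rpow_one x
  obtain ⟨hY0, hYge⟩ :=
    fiY_pos_and_ge (D := D) (θ := θ) (θ₁ := 1 / 3 - θ / 2) hx1 hR1x.1 le_rfl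
  have hsplit : x ^ (1 / 3 - θ / 2 : ℝ) = x ^ κ * L := by
    rw [hLdef, ← Real.rpow_add hx0]
    congr 1
    rw [hκ]; ring
  have hYeL : Real.exp 1 * L ≤ fiY D θ x := by
    calc Real.exp 1 * L ≤ x ^ κ * L := mul_le_mul_of_nonneg_right hxκ hL0.le
      _ = x ^ (1 / 3 - θ / 2 : ℝ) := hsplit.symm
      _ ≤ fiY D θ x := hYge
  have hsqrt_le : Real.sqrt x ≤ x := Real.sqrt_le_self_iff.mpr (Or.inr hx1)
  have heYx : Real.exp 1 * fiY D θ x ≤ x := heY.trans hsqrt_le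
  have hy0 : 0 ≤ y := hY0.le.trans hYy
  have hyx : y ≤ x := hyY.trans heYx
  have hyeL : Real.exp 1 * L ≤ y := hYeL.trans hYy
  have hy2L : 2 * L ≤ y := le_trans (mul_le_mul_of_nonneg_right he hL0.le) hyeL
  have hye : Real.exp 1 ≤ y := by
    calc Real.exp 1 = Real.exp 1 * 1 := (mul_one _).symm
      _ ≤ Real.exp 1 * L := mul_le_mul_of_nonneg_left hL1 (Real.exp_pos 1).le
      _ ≤ y := hyeL
  have hy1 : 1 ≤ y := by linarith
  -- `log (y/L) ≥ κ log x`, `log y ≥ κ log x`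
  have hlogyL : κ * Real.log x ≤ Real.log (y / L) := by
    have h1 : x ^ κ ≤ y / L := by
      rw [le_div_iff₀ hL0]
      calc x ^ κ * L = x ^ (1 / 3 - θ / 2 : ℝ) := hsplit.symm
        _ ≤ fiY D θ x := hYge
        _ ≤ y := hYy
    have := Real.log_le_log (Real.rpow_pos_of_pos hx0 _) h1
    rwa [Real.log_rpow hx0] at this
  have hκl0 : 0 < κ * Real.log x := mul_pos hκ0 hlogx0
  have hlogy : κ * Real.log x ≤ Real.log y :=
    hlogyL.trans (Real.log_le_log (by positivity) (div_le_self hy0 hL1))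
  have hlogyx : Real.log y ≤ Real.log x := Real.log_le_log (by linarith) hyx
  have hlogL : Real.log L ≤ Real.log x := Real.log_le_log hL0 hLx
  have hLfloor2 : (2 : ℝ) ≤ (⌊L⌋₊ : ℕ) := by
    have : (2 : ℕ) ≤ ⌊L⌋₊ := Nat.le_floor (by exact_mod_cast hL2)
    exact_mod_cast this
  have hlogLf : Real.log ⌊L⌋₊ ≤ Real.log x :=
    Real.log_le_log (by linarith) ((Nat.floor_le hL0.le).trans hLx)
  have hlogLf0 : 0 ≤ Real.log ⌊L⌋₊ := Real.log_nonneg (by linarith)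
  -- the box `⌊y⌋ ⌊L⌋ ≤ e √D ≤ D`
  have hYdef : fiY D θ x = Real.sqrt (D x) / L := by rw [hLdef]; rfl
  have hsqrtD : Real.exp 2 ≤ Real.sqrt (D x) := by
    have h1 : Real.sqrt (x ^ (2 / 3 : ℝ)) < Real.sqrt (D x) := Real.sqrt_lt_sqrt (by positivity) hR1x.1
    rw [Real.sqrt_eq_rpow, ← Real.rpow_mul hx0.le, show (2 / 3 : ℝ) * (1 / 2) = 1 / 3 by norm_num] at h1
    exact hx13.trans h1.le
  have hbox : (((⌊y⌋₊ * ⌊L⌋₊ : ℕ)) : ℝ) ≤ D x := by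
    push_cast
    calc (⌊y⌋₊ : ℝ) * ⌊L⌋₊ ≤ y * L :=
          mul_le_mul (Nat.floor_le hy0) (Nat.floor_le hL0.le) (Nat.cast_nonneg _) hy0
      _ ≤ (Real.exp 1 * fiY D θ x) * L := mul_le_mul_of_nonneg_right hyY hL0.le
      _ = Real.exp 1 * Real.sqrt (D x) := by rw [hYdef]; field_simp
      _ ≤ Real.sqrt (D x) * Real.sqrt (D x) :=
          mul_le_mul_of_nonneg_right (he12.trans hsqrtD) (Real.sqrt_nonneg _)
      _ = D x := Real.mul_self_sqrt hD0.le
  -- sizes and remainders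
  have hlam1 : ∀ ν, |lam x ν| ≤ 1 := hw.abs_le_one
  have hA0 : 0 ≤ A.size x := by rw [hhyp.size_eq]; exact A.congrSum_nonneg 1 x
  have hAt : ∀ t : ℝ, t ≤ x → 0 ≤ A.size t ∧ A.size t ≤ A.size x := fun t ht => by
    rw [hhyp.size_eq, hhyp.size_eq]
    exact ⟨A.congrSum_nonneg 1 t, A.congrSum_mono 1 ht⟩
  have hRem : ∀ t : ℝ, t ≤ x → ∑ d ∈ (Icc 1 ⌊D x⌋₊).filter Squarefree,
      (divisorCountK 5 d : ℝ) * |A.remainder d t| ≤ KR * A.size x / Real.log x ^ 3 := by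
    intro t ht
    refine (hRx t ht).trans ?_
    exact div_le_div_of_nonneg_right (mul_le_mul_of_nonneg_right (le_max_left _ _) hA0)
      (by positivity)
  -- (a) the main terms of `T₁`: `≤ C₁ (log x)^{-4}`
  have hMT1 : |∑ ν ∈ (Icc 1 ⌊L⌋₊).filter Squarefree, (lam x ν : ℝ) * A.density ν *
      ∑ b ∈ (Icc 1 ⌊y⌋₊).filter Squarefree, (μ b : ℝ) * A.density (b / Nat.gcd b ν)| ≤
      C₁ / Real.log x ^ 4 := by
    refine (abs_fi_T1_mainTerms_le A.density_mult hK h19 h24' hlam1 hL2 hy2L).trans ?_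
    have h1 : Real.log ⌊L⌋₊ ^ 2 ≤ Real.log x ^ 2 := pow_le_pow_left₀ hlogLf0 hlogLf 2
    have h2 : |K₂₄| / Real.log (y / L) ^ 6 ≤ |K₂₄| / (κ * Real.log x) ^ 6 :=
      div_le_div_of_nonneg_left (abs_nonneg _) (pow_pos hκl0 6) (pow_le_pow_left₀ hκl0.le hlogyL 6)
    have h20 : 0 ≤ |K₂₄| / Real.log (y / L) ^ 6 :=
      div_nonneg (abs_nonneg _) (pow_nonneg (hκl0.le.trans hlogyL) 6)
    calc E * Real.log ⌊L⌋₊ ^ 2 * (|K₂₄| / Real.log (y / L) ^ 6)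
        ≤ E * Real.log x ^ 2 * (|K₂₄| / (κ * Real.log x) ^ 6) :=
          mul_le_mul (mul_le_mul_of_nonneg_left h1 hE0.le) h2 h20 (by positivity)
      _ = C₁ / Real.log x ^ 4 := by
          rw [hC₁]
          field_simp
  -- (b) the main terms of `T₂` against the complete sum: `≤ C₂ (log x)^{-3}`
  have hMT2 : |(∑ ν ∈ (Icc 1 ⌊L⌋₊).filter Squarefree, (lam x ν : ℝ) * A.density ν *
      ∑ b ∈ (Icc 1 ⌊y⌋₊).filter Squarefree, (μ b : ℝ) * A.density (b / Nat.gcd b ν) * Real.log b) -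
      ∑ b ∈ Icc 1 ⌊y⌋₊, (μ b : ℝ) * A.density b * Real.log b| ≤ C₂ / Real.log x ^ 3 := by
    refine (abs_fi_T2_mainTerms_sub_le A.density_mult hK h19 h24' hw.map_one hlam1 hL2 hyeL).trans ?_
    have h1 : Real.log ⌊L⌋₊ ^ 2 ≤ Real.log x ^ 2 := pow_le_pow_left₀ hlogLf0 hlogLf 2
    have hlyL0 : 0 < Real.log (y / L) := lt_of_lt_of_le hκl0 hlogyL
    have h6 : Real.log L / Real.log (y / L) ^ 6 ≤ Real.log x / (κ * Real.log x) ^ 6 := by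
      calc Real.log L / Real.log (y / L) ^ 6 ≤ Real.log x / Real.log (y / L) ^ 6 :=
            div_le_div_of_nonneg_right hlogL (by positivity)
        _ ≤ Real.log x / (κ * Real.log x) ^ 6 :=
            div_le_div_of_nonneg_left hlogx0.le (pow_pos hκl0 6) (pow_le_pow_left₀ hκl0.le hlogyL 6)
    have h5 : 3 / Real.log (y / L) ^ 5 ≤ 3 / (κ * Real.log x) ^ 5 :=
      div_le_div_of_nonneg_left (by norm_num) (pow_pos hκl0 5) (pow_le_pow_left₀ hκl0.le hlogyL 5)
    have hpos : 0 ≤ Real.log L / Real.log (y / L) ^ 6 + 3 / Real.log (y / L) ^ 5 :=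
      add_nonneg (div_nonneg (Real.log_nonneg hL1) (by positivity)) (by positivity)
    calc E * Real.log ⌊L⌋₊ ^ 2 *
          (|K₂₄| * (Real.log L / Real.log (y / L) ^ 6 + 3 / Real.log (y / L) ^ 5))
        ≤ E * Real.log x ^ 2 *
          (|K₂₄| * (Real.log x / (κ * Real.log x) ^ 6 + 3 / (κ * Real.log x) ^ 5)) :=
          mul_le_mul (mul_le_mul_of_nonneg_left h1 hE0.le)
            (mul_le_mul_of_nonneg_left (add_le_add h6 h5) (abs_nonneg _))
            (mul_nonneg (abs_nonneg _) hpos) (by positivity)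
      _ = C₂ / Real.log x ^ 3 := by
          rw [hC₂]
          field_simp
  -- (c) the complete sum against `-H`: `≤ C₃ (log x)^{-5}`
  have hQH : |(∑ b ∈ Icc 1 ⌊y⌋₊, (μ b : ℝ) * A.density b * Real.log b) + H| ≤ C₃ / Real.log x ^ 5 := by
    refine (abs_sum_moebius_density_log_add_le h24' h13' hye).trans ?_
    calc 3 * |K₂₄| / Real.log y ^ 5 ≤ 3 * |K₂₄| / (κ * Real.log x) ^ 5 :=
          div_le_div_of_nonneg_left (by positivity) (pow_pos hκl0 5) (pow_le_pow_left₀ hκl0.le hlogy 5)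
      _ = C₃ / Real.log x ^ 5 := by rw [hC₃, mul_pow, div_div]
  -- the decomposition `T = T₁ - T₂'`
  rw [A.fiT_eq_T1_sub_T2 (lam x) hy0]
  -- (d) `T₂' = A(x) · MT₂ + RT₂`
  have hT2 := hhyp.sum_phi_V_eq_main_add_rem hw hL0.le (fun b => (μ b : ℝ) * Real.log b) ⌊y⌋₊ x
  have hMT2eq := fi_pairMainTerms_eq A.density_mult (lam x) (fun b => (μ b : ℝ) * Real.log b) ⌊y⌋₊ ⌊L⌋₊
  have hMT2eq' : ∑ ν ∈ (Icc 1 ⌊L⌋₊).filter Squarefree, (lam x ν : ℝ) * A.density ν *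
        ∑ b ∈ (Icc 1 ⌊y⌋₊).filter Squarefree, (μ b : ℝ) * Real.log b * A.density (b / Nat.gcd b ν) =
      ∑ ν ∈ (Icc 1 ⌊L⌋₊).filter Squarefree, (lam x ν : ℝ) * A.density ν *
        ∑ b ∈ (Icc 1 ⌊y⌋₊).filter Squarefree, (μ b : ℝ) * A.density (b / Nat.gcd b ν) * Real.log b := by
    refine Finset.sum_congr rfl fun ν _ => ?_
    congr 1
    exact Finset.sum_congr rfl fun b _ => by ring
  have hφ₂ : ∀ b ∈ Icc 1 ⌊y⌋₊, |(μ b : ℝ) * Real.log b| ≤ Real.log x := by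
    intro b hb
    obtain ⟨hb1, hby⟩ := Finset.mem_Icc.mp hb
    have hb1r : (1 : ℝ) ≤ b := by exact_mod_cast hb1
    have hby' : (b : ℝ) ≤ y := (Nat.cast_le.mpr hby).trans (Nat.floor_le hy0)
    have hμ : |(μ b : ℝ)| ≤ 1 := by exact_mod_cast ArithmeticFunction.abs_moebius_le_one
    rw [abs_mul, abs_of_nonneg (Real.log_nonneg hb1r)]
    calc |(μ b : ℝ)| * Real.log b ≤ 1 * Real.log x :=
          mul_le_mul hμ ((Real.log_le_log (by linarith) hby').trans hlogyx) (Real.log_nonneg hb1r)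
            zero_le_one
      _ = Real.log x := one_mul _
  have hRT2 : |∑ b ∈ Icc 1 ⌊y⌋₊, ∑ ν ∈ Icc 1 ⌊L⌋₊,
      (if Squarefree (Nat.lcm b ν) then (μ b : ℝ) * Real.log b * (lam x ν : ℝ) *
        A.remainder (Nat.lcm b ν) x else 0)| ≤ Real.log x * (KR * A.size x / Real.log x ^ 3) :=
    (A.abs_pairRemTerms_le hlam1 hlogx0.le (φ := fun b => (μ b : ℝ) * Real.log b) hφ₂ hbox x).trans
      (mul_le_mul_of_nonneg_left (hRem x le_rfl) hlogx0.le)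
  -- (e) `T₁` by partial summation: all partial sums are `≤ B`
  set B := A.size x * (C₁ / Real.log x ^ 4) + 1 * (KR * A.size x / Real.log x ^ 3) with hB
  have hW : ∀ N : ℕ, N ≤ ⌊x⌋₊ →
      |∑ n ∈ Icc 1 N, A.a n * (sieveRho (lam x) n : ℝ) *
        (truncLE (μ : ArithmeticFunction ℝ) y * ζ) n| ≤ B := by
    intro N hN
    have hNx : (N : ℝ) ≤ x := (Nat.cast_le.mpr hN).trans (Nat.floor_le hx0.le)
    have hW1 : ∑ n ∈ Icc 1 N, A.a n * (sieveRho (lam x) n : ℝ) *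
        (truncLE (μ : ArithmeticFunction ℝ) y * ζ) n =
        A.rhoSum (lam x) (truncLE (μ : ArithmeticFunction ℝ) y * ζ) N := by
      rw [SieveSequence.rhoSum, Nat.floor_natCast]
    rw [hW1, A.rhoSum_truncLE_mul_zeta (lam x) _ hy0 N]
    simp only [ArithmeticFunction.intCoe_apply]
    have hdec := hhyp.sum_phi_V_eq_main_add_rem hw hL0.le (fun b => (μ b : ℝ)) ⌊y⌋₊ (N : ℝ)
    have hMT1eq := fi_pairMainTerms_eq A.density_mult (lam x) (fun b => (μ b : ℝ)) ⌊y⌋₊ ⌊L⌋₊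
    rw [hdec, hMT1eq]
    obtain ⟨hAN0, hANx⟩ := hAt N hNx
    have hμ1 : ∀ b ∈ Icc 1 ⌊y⌋₊, |(μ b : ℝ)| ≤ 1 := fun b _ => by
      exact_mod_cast ArithmeticFunction.abs_moebius_le_one
    have hR1 := (A.abs_pairRemTerms_le hlam1 zero_le_one (φ := fun b => (μ b : ℝ)) hμ1 hbox (N : ℝ)).trans
      (mul_le_mul_of_nonneg_left (hRem N hNx) zero_le_one)
    refine (abs_add_le _ _).trans (add_le_add ?_ hR1)
    rw [abs_mul, abs_of_nonneg hAN0]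
    exact mul_le_mul hANx hMT1 (abs_nonneg _) hA0
  have hT1 := abs_sum_Icc_mul_log_le hW
  have hB0 : 0 ≤ B := by positivity
  have hlogX : Real.log ⌊x⌋₊ ≤ Real.log x := by
    have hX1 : (1 : ℝ) ≤ ⌊x⌋₊ := by
      have : 1 ≤ ⌊x⌋₊ := Nat.le_floor (by exact_mod_cast hx1)
      exact_mod_cast this
    exact Real.log_le_log (by linarith) (Nat.floor_le hx0.le)
  have hT1' : |∑ n ∈ Icc 1 ⌊x⌋₊, A.a n * (sieveRho (lam x) n : ℝ) *
      (truncLE (μ : ArithmeticFunction ℝ) y * ζ) n * Real.log n| ≤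
      2 * (C₁ + KR) * A.size x / Real.log x ^ 2 := by
    refine hT1.trans ?_
    calc 2 * B * Real.log ⌊x⌋₊ ≤ 2 * B * Real.log x :=
          mul_le_mul_of_nonneg_left hlogX (by positivity)
      _ = 2 * C₁ * A.size x / Real.log x ^ 3 + 2 * KR * A.size x / Real.log x ^ 2 := by
          rw [hB]
          field_simp
      _ ≤ 2 * C₁ * A.size x / Real.log x ^ 2 + 2 * KR * A.size x / Real.log x ^ 2 :=
          add_le_add (mul_div_log_pow_le_of_two_le (by positivity) hA0 hlogx (by norm_num)) le_rfl
      _ = 2 * (C₁ + KR) * A.size x / Real.log x ^ 2 := by ring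
  -- (f) combine
  rw [hT2, hMT2eq, hMT2eq']
  set T1 := ∑ n ∈ Icc 1 ⌊x⌋₊, A.a n * (sieveRho (lam x) n : ℝ) *
      (truncLE (μ : ArithmeticFunction ℝ) y * ζ) n * Real.log n with hT1def
  set M2 := ∑ ν ∈ (Icc 1 ⌊L⌋₊).filter Squarefree, (lam x ν : ℝ) * A.density ν *
        ∑ b ∈ (Icc 1 ⌊y⌋₊).filter Squarefree, (μ b : ℝ) * A.density (b / Nat.gcd b ν) * Real.log b
    with hM2def
  set Q := ∑ b ∈ Icc 1 ⌊y⌋₊, (μ b : ℝ) * A.density b * Real.log b with hQdef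
  set R2 := ∑ b ∈ Icc 1 ⌊y⌋₊, ∑ ν ∈ Icc 1 ⌊L⌋₊,
      (if Squarefree (Nat.lcm b ν) then (μ b : ℝ) * Real.log b * (lam x ν : ℝ) *
        A.remainder (Nat.lcm b ν) x else 0) with hR2def
  have hsplit2 : T1 - (A.size x * M2 + R2) - H * A.size x =
      T1 - A.size x * (M2 - Q) - A.size x * (Q + H) - R2 := by ring
  rw [hsplit2]
  have h2 : |A.size x * (M2 - Q)| ≤ C₂ * A.size x / Real.log x ^ 2 := by
    rw [abs_mul, abs_of_nonneg hA0]
    calc A.size x * |M2 - Q| ≤ A.size x * (C₂ / Real.log x ^ 3) := mul_le_mul_of_nonneg_left hMT2 hA0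
      _ = C₂ * A.size x / Real.log x ^ 3 := by ring
      _ ≤ C₂ * A.size x / Real.log x ^ 2 := mul_div_log_pow_le_of_two_le hC₂0 hA0 hlogx (by norm_num)
  have h3 : |A.size x * (Q + H)| ≤ C₃ * A.size x / Real.log x ^ 2 := by
    rw [abs_mul, abs_of_nonneg hA0]
    calc A.size x * |Q + H| ≤ A.size x * (C₃ / Real.log x ^ 5) := mul_le_mul_of_nonneg_left hQH hA0
      _ = C₃ * A.size x / Real.log x ^ 5 := by ring
      _ ≤ C₃ * A.size x / Real.log x ^ 2 := mul_div_log_pow_le_of_two_le hC₃0 hA0 hlogx (by norm_num)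
  have h4 : |R2| ≤ KR * A.size x / Real.log x ^ 2 := by
    refine hRT2.trans (le_of_eq ?_)
    field_simp
  calc |T1 - A.size x * (M2 - Q) - A.size x * (Q + H) - R2|
      ≤ |T1| + |A.size x * (M2 - Q)| + |A.size x * (Q + H)| + |R2| := by
        have := abs_sub (T1 - A.size x * (M2 - Q) - A.size x * (Q + H)) R2
        have := abs_sub_sub_le T1 (A.size x * (M2 - Q)) (A.size x * (Q + H))
        linarith
    _ ≤ 2 * (C₁ + KR) * A.size x / Real.log x ^ 2 + C₂ * A.size x / Real.log x ^ 2 +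
          C₃ * A.size x / Real.log x ^ 2 + KR * A.size x / Real.log x ^ 2 :=
        add_le_add (add_le_add (add_le_add hT1' h2) h3) h4
    _ = (2 * (C₁ + KR) + C₂ + C₃ + KR) * A.size x / Real.log x ^ 2 := by ring

end Literature.NumberTheory.Sieve
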